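import Literature.Claims.NS.ClayPeriodScalingBridge
import Literature.Claims.NS.ClayR3BKMBridge
import Literature.Analysis.FluidPDE.ClayClassLerayHopfUniqueness
import Literature.Analysis.FluidPDE.TorusStrainVorticityIsometry
import Literature.Analysis.FluidPDE.VorticityCalculus
import Literature.Analysis.FunctionSpaces.FlatTorusProofs
import Literature.Claims.NS.ClayHorizonBridge
import Literature.Analysis.FluidPDE.ClassicalSolutionRescale
import Literature.Analysis.FunctionSpaces.TorusFluidGlueProofs
import Literature.Claims.NS.ClayPeriodicBlowupAlternative
import Literature.Analysis.FluidPDE.TorusNSBealeKatoMajda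
import Literature.Analysis.FluidPDE.TorusClassicalH1Balance
import Literature.Analysis.FluidPDE.TorusStrainVorticityOrthogonality
import Literature.Analysis.FluidPDE.LocalBiotSavartCalculus
import Literature.Analysis.FunctionSpaces.TorusPeriodization
import Mathlib.Analysis.Real.Pi.Bounds
import Mathlib.MeasureTheory.Measure.Haar.NormedSpace
import HarnessLib

/-!
# Claim skeleton C154 — Wayman, «Navier–Stokes regularity on the algebraic torus from Cl(1,6) shear
# locking» (Zenodo 18719808, 2026-02-21, 36 pp.)

**Cite header.** Justin Wayman (Independent researcher, as printed p.1 l.59–62), *Navier–Stokes regularity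
on the algebraic torus from Cl(1,6) shear locking*, Zenodo record 18719808 (concept 18719807; one
version; file `Wayman_NavierStokes_Cl16.pdf`, sha256[:16] e577f370cc8e4527, 36 pp., PDF page = printed
page = pin file `census/texts/Wayman2026/pages/pNNN.txt`, `l.N` = line of that text layer; «Commun.
Math. Phys. manuscript No. (will be inserted by the editor)» is the LaTeX template, not a venue).
SOURCED ns-claims-lit-3 g7 10:52:47Z, LOCATORS `sources/Wayman2026/LOCATORS.md` v1. Bib key
`Wayman2026`. UNREFEREED CLAIM under adjudication (D-0090 NS-claims sweep, cell `ns-claims`, row C154,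
tranche 3, T3 medium–high «own-framework algebra»; typist re-pointed RULINGS 11:03Z (1)) — this file
TYPES the claimed statement and the load-bearing displays of the printed chain as `Prop`s and ASSERTS
NONE OF THEM; the theorems below are compositions by pure logic, two identities of constants, and the
Clay (B) link. Nothing here is a theorem about Navier–Stokes. [cite: Wayman2026, abstract p.1 l.7–58; Thm 13 p.30 l.49 – p.31 l.20]

**Claimed statement (verbatim, Thm 13 «Main result» p.30 l.49 – p.31 l.17).** «Let T³(a*) be the flat
three-torus with modulus a* = π/√3 determined by the Clifford algebra Cl(1,6). For any ν > 0 and any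
smooth divergence-free initial velocity u₀ ∈ C^∞(T³(a*); R³): 1. (Global existence and uniqueness.)
There exists a unique global smooth solution u ∈ C^∞(T³(a*) × [0,∞); R³). No finite-time singularity
forms. 2. (Geometric decay.) The peak vorticity decays geometrically: ‖ω(kτ)‖_{L∞} ≤ ‖ω₀‖_{L∞} γ^k,
where τ = 2π/√3 is the interaction time and γ = (π²−3)/(2√3π) ≈ 0.631. 3. (Energy bound.) The energy
satisfies E(t) ≤ E(0) for all t ≥ 0.» + Prop 14 p.31 l.21–25 «Theorem 13 holds on every cubic flat
three-torus T³(L) with equal side lengths L > 0, for any ν > 0 and any smooth divergence-free initial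
data.» RENDERING: the torus `T³(a*)` is rendered as `ℝ³` with `L`-periodic fields, `L = per = 2πa* =
2π²/√3` (Def 5 p.7 l.23–26 «All functions are periodic with period L = 2πa* = 2π²/√3»); a «global
smooth solution» is a Clay-sense one (`u, p` smooth on the closed half-space, (15)–(16) with no force,
`u(·,0) = u₀`, velocity AND pressure slices `L`-periodic); norms `‖·‖_{L∞}` are sups over `ℝ³` (= over
one cell for periodic fields), `L²`-type quantities are integrals over the cell `[0,L)³`.
`ClaimedTheorem := Thm13_1 ∧ Thm13_2 ∧ Thm13_3`; `ClaimedCubic` = Prop 14.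

**Clay delta (reference `Literature.Claims.NS.ClayVariants`).** Nearest statement (B)
`clayPeriodic.Regularity`. Δ1 domain: the cubic torus of side `2π²/√3` — by Prop 14 (printed) every
cubic torus, in particular Fefferman's `ℝ³/ℤ³`; independently EQUIVALENT to period 1 by Leray's scaling
(tree `ClayVariants.clayPeriodic_solvable_nsRescaleData_iff`) · Δ2 (15)–(16) ✓ · Δ3 `f ≡ 0` (narrower
than (B)'s forced class — (B) with `f ≡ 0` is what is compared) · Δ4 data smooth periodic div-free ✓ ·
Δ5/Δ6 conclusion ⊇ (B) (+ uniqueness + the decay law (2) + the energy bound (3), EXTRA printed content)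
· Δ7 ∀ ν > 0 ✓. No hidden smallness printed anywhere («any smooth divergence-free initial data», «no
free parameters beyond ν», p.2 l.2–3). `clay_of_cubic : ClaimedCubic → clayPeriodic.Regularity` PROVED
(L = 1); `clay_of_claimed : ClaimedTheorem → Step_Prop14 → clayPeriodic.Regularity` (the printed
rescaling as the bridge hypothesis) and `clay_of_thm13_1 : Thm13_1 → clayPeriodic.Regularity` PROVED
through the tree's period-scaling bridge (no delta in substance).

**ORDERED STEP INDEX** (print order along the chain of Thm 13's proof p.31 l.18–20 and Thm 11's proof
p.27; every `def … : Prop` tagged `[claim: Wayman2026, status: under-review]`):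
* constants: `aStar` (Def 2 p.6 l.26), `per` (Def 5 p.7 l.23–26), `lam1` (Lemma 1 (18) p.7), `Kc` =
  tanh³δ_h = (π²−3)^{3/2}/π³ (Prop 8 (38) p.13), `Ginf` ((49) p.18), `gam` ((50) p.18), `tau` = 2π/√3
  (p.3 l.6; Thm 13 (2)); `lemma1_spectralGap : 1/aStar² = lam1` and `thm8_loopGain : Ginf·Kc = gam`
  PROVED (Thm 8 p.18 l.69–112 is arithmetic).
* `Step_L2` — Lemma 2 (22) p.7 l.102–109 «E(t) ≤ E(0)» (TRUE-type).
* `Step_P4` — Prop 4 (26) p.8 l.62–67, the enstrophy identity (TRUE-type).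
* `Step_P9` — Prop 9 (44) p.16 l.9–26 «|∫ω_iS_ijω_j| ≤ tanh³δ_h·‖ω‖_{L∞}·Ω» (fields grain; TRUE-type —
  see the docstring: the classical constant is `1/√3 < tanh³δ_h`).
* `Step_T7` — Thm 7 (48) p.17 l.47–55; `thm7_of_steps : Step_P4 → Step_P9 → Step_T7` PROVED.
* `Step_T9` — **Thm 9 (53) p.21 l.2–17** (= p.3 l.4–7 = Thm 13 (2)): «for every smooth divergence-free
  u₀ … ‖ω(kτ)‖_{L∞} ≤ ‖ω₀‖_{L∞}γ^k» — the first display asserting a datum- and ν-UNIFORM decay.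
  Alongside (its printed derivation): `Step_T9_61` (Step 4 (61) p.22 l.40–47), `Step_T9_stage1`
  (Step 5 Stage 1 p.22 l.49–59, as the implication it asserts).
* `Step_C1` — Cor 1 (65) p.23 l.30–43 (Closure B); `Step_T10` — Thm 10 (67) p.24 l.4–23 (Closure C).
* `Step11_1` — Thm 11 Step 1 p.27 l.4–12 (Fujita–Kato + BKM (71) on the torus; TRUE-type, as the
  implication «a priori sup-vorticity bound on every slab ⇒ global smooth solution»).
* `Step11_2` — (72) p.27 l.13–32 «‖ω[k]‖_{L∞} ≤ Cγ^k, C depending on ‖u₀‖_{H^s} and ν»;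
  `step11_2_of_thm9`, `step11_2_of_cor1` PROVED; `Step11_2c : Step_T10 → Step11_2` (route (2c), typed as
  the implication the text asserts).
* `Step11_3_interval` — p.27 l.43–49; `Step11_3` — the BKM closure (73)–(74) p.27 l.33–75 as the
  implication «(72) ∧ interval bound ⇒ a priori sup-vorticity bound».
* `Step11_unique` — Thm 11 «unique» p.26 l.47 (classical; TRUE-type).
* `Step_Prop14` — Prop 14 p.31 l.26–90, the rescaling (79) (TRUE-type; tree `ClayPeriodScalingBridge`).
* REV 2 (additive, REF-2 WANT 11:32:02Z): `IsMode`, `IsTriad`, `IsPolar`, `kappa` (Γ (36), κ (37) p.13)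
  and `Step_P8_le` / `Step_P8` — Prop 8 (38) p.13 l.58–72 at the literal finite-dimensional triad grain,
  ALONGSIDE (the chain consumes (38) only through `Kc`).
COMPOSITION: `globalExistence_of_steps`, `thm13_2_of_thm9`, `thm13_3_of_lemma2`, `claim_of_steps`
PROVED (pure logic); `clay_of_cubic`, `clay_of_thm13_1`, `clay_of_claimed` PROVED.

Typist's advisory flags (docstrings; the verdict is the refuter's, nothing is asserted): `Step_T9` /
`Thm13_2` / `Step_C1` / `Step11_2` SUSPICIOUS — a geometric decay of `‖ω(kτ)‖_{L∞}` at the universal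
ratio `γ ≈ 0.631` per `τ = 2π/√3` for EVERY datum and EVERY `ν > 0`, while the Stokes eigenmode
`u = (sin(y/a*), 0, 0)e^{−νλ₁t}` (an exact solution, zero nonlinearity) decays by `e^{−νλ₁τ} > γ` per
period as soon as `ν < ln(1/γ)/(λ₁τ) ≈ 0.42`; `Step_T9_stage1`, `Step11_2c`, `Step11_3` SUSPICIOUS as
inferences (small-gain for a linear loop applied to the quadratic stretching; (67) carries a
non-decaying term; the interval sup is absorbed with a datum-free γ); `Step_T10`, `Step11_1`'s
antecedent are a-priori faces of (B) strength. TRUE-type: `Step_L2`, `Step_P4`, `Step_P9`, `Step_T7`,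
`Step11_1`, `Step11_unique`, `Step_Prop14`, Thm 8 (PROVED), Lemma 1 (PROVED).

D-0026: every `def … : Prop` below is a HYPOTHESIS of the claim under adjudication (statement typing),
not a Literature fact; no instance, no notation, no axiom, no sorry. §2–§3 (Cl(1,6) «derivation» of
a*), §8 (transfer functions), §13–§14 (beams, nuclei), §16 are the author's framework/discussion and are
not typed beyond the constants they export.

WHAT THIS IS NOT: not a claim about NS regularity or blow-up; not a claim about any author beyond the
typed locator.
-/

noncomputable section

open Set MeasureTheory Literature.Analysis.FluidPDE
open scoped ENNReal NNReal ContDiff RealInnerProductSpace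

namespace Literature.Claims.NS.Wayman2026

open Literature.Analysis.FluidPDE Literature.Claims.NS.ClayVariants

/-! ## Vocabulary: the torus `T³(a*)` as `ℝ³` with `L`-periodic fields, and the paper's constants -/

/-- Physical space `ℝ³`. [folklore] -/
abbrev E3 : Type := EuclideanSpace ℝ (Fin 3)

/-- The «algebraic modulus» `a* = π/√3` (Def 2 p.6 l.26; abstract p.1 l.13–15). [cite: Wayman2026, Def 2 p.6 l.26] -/
def aStar : ℝ := Real.pi / Real.sqrt 3

/-- The period `L = 2πa* = 2π²/√3` of `T³(a*)` (Def 5 p.7 l.23–26 «All functions are periodic with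
period L = 2πa* = 2π²/√3»). [cite: Wayman2026, Def 5 p.7 l.23–26] -/
def per : ℝ := 2 * Real.pi * aStar

/-- The spectral gap `λ₁ = 3/π²` (Lemma 1 (18) p.7 l.44–58). [cite: Wayman2026, Lemma 1 (18) p.7] -/
def lam1 : ℝ := 3 / Real.pi ^ 2

/-- `K = tanh³δ_h = (π²−3)^{3/2}/π³ ≈ 0.5807` (Prop 8 (38) p.13 l.58–72; abstract (d)).
[cite: Wayman2026, Prop 8 (38) p.13 l.58–72] -/
def Kc : ℝ := (Real.pi ^ 2 - 3) ^ (3 / 2 : ℝ) / Real.pi ^ 3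

/-- `‖G‖∞ = π²/√(12(π²−3)) ≈ 1.087` (Prop 10 (49) p.18 l.14–32; the peak gain of the LINEARISED modal
system of Prop 6, ν → 0⁺, |n| = 1). [cite: Wayman2026, Prop 10 (49) p.18 l.14–32] -/
def Ginf : ℝ := Real.pi ^ 2 / Real.sqrt (12 * (Real.pi ^ 2 - 3))

/-- The «loop gain» `γ = (π²−3)/(2√3π) ≈ 0.631` (Thm 8 (50) p.18 l.69–83; Thm 13 (2)).
[cite: Wayman2026, Thm 8 (50) p.18 l.69–83] -/
def gam : ℝ := (Real.pi ^ 2 - 3) / (2 * Real.sqrt 3 * Real.pi)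

/-- The «interaction time» `τ = 2π/√3` (p.3 l.6; Thm 13 (2) p.31 l.12). [cite: Wayman2026, Thm 13 (2) p.31 l.10–14] -/
def tau : ℝ := 2 * Real.pi / Real.sqrt 3

/-- `L`-periodicity of a field on `ℝ³` in every coordinate direction (a function on `T³ = ℝ³/Lℤ³`;
Def 5 p.7 l.26). [cite: Wayman2026, Def 5 p.7 l.23–26] -/
def IsPer {X : Type*} (L : ℝ) (v : E3 → X) : Prop :=
  ∀ (j : Fin 3) (x : E3), v (x + L • EuclideanSpace.single j 1) = v x

/-- The period cell `[0,L)³` (integrals «over T³» are integrals over one cell). [cite: Wayman2026, Def 7 (19)–(21) p.7] -/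
def cell (L : ℝ) : Set E3 := {x | ∀ i, x i ∈ Ico 0 L}

/-- **The datum class** (Def 5 p.7 l.21–23; Thm 13 p.30 l.52–54 «any smooth divergence-free initial
velocity u₀ ∈ C^∞(T³(a*); R³)»), on the torus of period `L`. [cite: Wayman2026, Def 5 p.7 l.21–26; Thm 13 p.30 l.49–54] -/
def IsDatum (L : ℝ) (u₀ : E3 → E3) : Prop :=
  ContDiff ℝ ∞ u₀ ∧ NSWave0.IsDivFree u₀ ∧ IsPer L u₀

/-- **The class the printed argument runs in** (Thm 9 Step 1 p.21 l.20–23 «a unique smooth solution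
exists on a maximal interval [0,T*)»; Thm 11 Step 1 p.27 l.4–12): a classical solution of (15)–(16)
(no force) on `ℝ³ × [0,T)` from the datum, with `L`-periodic velocity and pressure slices.
[cite: Wayman2026, Thm 9 Step 1 p.21 l.20–23; Thm 11 Step 1 p.27 l.4–12] -/
structure IsSol (L ν T : ℝ) (u₀ : E3 → E3) (u : ℝ → E3 → E3) (p : ℝ → E3 → ℝ) : Prop where
  datum : IsDatum L u₀
  classical : IsClassicalNSSolutionOn (Ico 0 T) ν 0 u p
  initial : u 0 = u₀
  perU : ∀ t ∈ Ico 0 T, IsPer L (u t)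
  perP : ∀ t ∈ Ico 0 T, IsPer L (p t)

/-- **A global smooth solution on `T³(L)`** in the Clay sense («u ∈ C^∞(T³(a*) × [0,∞); R³)», Thm 13 (1);
(15)–(16) with pressure `p`; all functions `L`-periodic, Def 5): `u, p` smooth on the closed half-space,
Navier–Stokes with no force from `u₀`, velocity and pressure slices `L`-periodic at every `t ≥ 0`.
[cite: Wayman2026, Thm 13 (1) p.30 l.55 – p.31 l.5; Def 5 p.7 l.7–26] -/
def IsGlobalSol (L ν : ℝ) (u₀ : E3 → E3) (u : ℝ → E3 → E3) (p : ℝ → E3 → ℝ) : Prop :=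
  IsSmoothOnHalfSpace u ∧ IsSmoothOnHalfSpace p ∧ IsNavierStokesSolution ν 0 u₀ u p ∧
    (∀ t : ℝ, 0 ≤ t → IsPer L (u t)) ∧ (∀ t : ℝ, 0 ≤ t → IsPer L (p t))

/-- `E = ½∫_{T³}|u|²` ((19) p.7). [cite: Wayman2026, Def 7 (19) p.7 l.75–85] -/
def En (L : ℝ) (v : E3 → E3) : ℝ := (1 / 2) * ∫ x in cell L, ‖v x‖ ^ 2

/-- `Ω = ∫_{T³}|ω|²` (enstrophy, (20) p.7; `ω = ∇ × u`). [cite: Wayman2026, Def 7 (20) p.7 l.86–95] -/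
def Ens (L : ℝ) (v : E3 → E3) : ℝ := ∫ x in cell L, ‖curl v x‖ ^ 2

/-- `P = ∫_{T³}|∇ω|²` (palinstrophy, (21) p.7; Hilbert–Schmidt square of `∇ω`).
[cite: Wayman2026, Def 7 (21) p.7 l.96–101] -/
def Pal (L : ℝ) (v : E3 → E3) : ℝ := ∫ x in cell L, frobeniusNormSq (fderiv ℝ (curl v) x)

/-- The vortex-stretching integral `∫_{T³} ω_i S_ij ω_j` ((26) p.8; `ω·Sω = ω·(∇u)ω`).
[cite: Wayman2026, Prop 4 (26) p.8 l.62–67] -/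
def stretch (L : ℝ) (v : E3 → E3) : ℝ := ∫ x in cell L, ⟪curl v x, fderiv ℝ v x (curl v x)⟫

/-- `‖w‖_{L∞}` = the supremum over `ℝ³` (for an `L`-periodic continuous field, the maximum over one cell;
real supremum). [cite: Wayman2026, Thm 9 (53) p.21; Prop 9 (44) p.16] -/
def supN (w : E3 → E3) : ℝ := ⨆ x, ‖w x‖

/-- `‖w‖_{L²(T³)}`. [cite: Wayman2026, (60) p.22 l.44–45] -/
def l2N (L : ℝ) (w : E3 → E3) : ℝ := Real.sqrt (∫ x in cell L, ‖w x‖ ^ 2)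

/-! ## The claimed statement (Thm 13 p.30–31; Prop 14 p.31) -/

/-- **Thm 13 (1) p.30 l.55 – p.31 l.5** «(Global existence and uniqueness.) There exists a unique global
smooth solution u ∈ C^∞(T³(a*) × [0,∞); R³). No finite-time singularity forms.» — on the torus of period
`L`: existence of a global Clay-sense solution from every datum, and uniqueness of its velocity among
such solutions. [claim: Wayman2026, status: under-review] [cite: Wayman2026, Thm 13 (1) p.30 l.55 – p.31 l.5; Thm 11 p.26 l.43–70] -/
def Thm13_1 (L : ℝ) : Prop :=
  ∀ ν : ℝ, 0 < ν → ∀ u₀ : E3 → E3, IsDatum L u₀ →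
    (∃ (u : ℝ → E3 → E3) (p : ℝ → E3 → ℝ), IsGlobalSol L ν u₀ u p) ∧
    ∀ (u₁ : ℝ → E3 → E3) (p₁ : ℝ → E3 → ℝ) (u₂ : ℝ → E3 → E3) (p₂ : ℝ → E3 → ℝ),
      IsGlobalSol L ν u₀ u₁ p₁ → IsGlobalSol L ν u₀ u₂ p₂ → ∀ t : ℝ, 0 ≤ t → u₁ t = u₂ t

/-- **Thm 13 (2) p.31 l.6–14** «(Geometric decay.) The peak vorticity decays geometrically:
‖ω(kτ)‖_{L∞} ≤ ‖ω₀‖_{L∞} γ^k, where τ = 2π/√3 is the interaction time and γ = (π²−3)/(2√3π) ≈ 0.631»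
— along every global Clay-sense solution on the torus of period `L` with interaction time `T₁`
(`T₁ = tau` on `T³(a*)`; Prop 14's rescaling (79) sends `τ` to `τ·(L/per)²`), for every `k : ℕ`, every
datum, EVERY `ν > 0`. Typist's flag: SUSPICIOUS (datum- and ν-uniform ratio `γ` per period; the Stokes
eigenmode decays by `e^{−νλ₁τ} > γ` when `ν` is small). [claim: Wayman2026, status: under-review]
[cite: Wayman2026, Thm 13 (2) p.31 l.6–14; (53) p.21 l.14–17; p.3 l.4–7] -/
def Thm13_2 (L T₁ : ℝ) : Prop :=
  ∀ ν : ℝ, 0 < ν → ∀ u₀ : E3 → E3, IsDatum L u₀ →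
    ∀ (u : ℝ → E3 → E3) (p : ℝ → E3 → ℝ), IsGlobalSol L ν u₀ u p →
      ∀ k : ℕ, supN (curl (u ((k : ℝ) * T₁))) ≤ supN (curl u₀) * gam ^ k

/-- **Thm 13 (3) p.31 l.15–17** «(Energy bound.) The energy satisfies E(t) ≤ E(0) for all t ≥ 0» (= Lemma 2
(22) p.7). [claim: Wayman2026, status: under-review] [cite: Wayman2026, Thm 13 (3) p.31 l.15–17; Lemma 2 (22) p.7 l.102–109] -/
def Thm13_3 (L : ℝ) : Prop :=
  ∀ ν : ℝ, 0 < ν → ∀ u₀ : E3 → E3, IsDatum L u₀ →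
    ∀ (u : ℝ → E3 → E3) (p : ℝ → E3 → ℝ), IsGlobalSol L ν u₀ u p → ∀ t : ℝ, 0 ≤ t → En L (u t) ≤ En L u₀

/-- **CLAIMED THEOREM = Thm 13 «Main result: global regularity on T³(a*)» p.30 l.49 – p.31 l.17, as
printed** (all three parts, on the torus of period `per = 2π²/√3`, interaction time `tau = 2π/√3`).
[claim: Wayman2026, status: under-review] [cite: Wayman2026, Thm 13 p.30 l.49 – p.31 l.17; abstract p.1 l.7–58] -/
def ClaimedTheorem : Prop :=
  Thm13_1 per ∧ Thm13_2 per tau ∧ Thm13_3 per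

/-- **Prop 14 p.31 l.21–25** «(Rescaling to arbitrary cubic tori) Theorem 13 holds on every cubic flat
three-torus T³(L) with equal side lengths L > 0, for any ν > 0 and any smooth divergence-free initial
data» — all three parts, with the interaction time transported by the printed rescaling (79)
(`τ_L = τ·(L/per)²`, same viscosity, «the loop gain γ … is scale-invariant» l.62–77).
[claim: Wayman2026, status: under-review] [cite: Wayman2026, Prop 14 p.31 l.21–90] -/
def ClaimedCubic : Prop :=
  ∀ L : ℝ, 0 < L → Thm13_1 L ∧ Thm13_2 L (tau * (L / per) ^ 2) ∧ Thm13_3 L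

/-! ## Constants: Lemma 1 and Thm 8 are arithmetic (PROVED) -/

/-- **Lemma 1 (Spectral gap) (18) p.7 l.44–58** «λ₁ = 1/(a*)² = 3/π²» — arithmetic on `a* = π/√3`; PROVED.
[cite: Wayman2026, Lemma 1 (18) p.7 l.44–58] -/
theorem lemma1_spectralGap : 1 / aStar ^ 2 = lam1 := by
  unfold aStar lam1
  have h3 : Real.sqrt 3 ^ 2 = 3 := Real.sq_sqrt (by norm_num)
  have hπ : Real.pi ≠ 0 := Real.pi_ne_zero
  rw [div_pow, h3, one_div_div]

/-- **Thm 8 (Loop gain) (50) p.18 l.69–112** «γ := ‖G‖∞ · K = (π²−3)/(2√3π)» — arithmetic on the two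
printed constants (49) and (38); PROVED (the numerical value `≈ 0.631 < 1` is not used by the kernel
relations below). [cite: Wayman2026, Thm 8 (50) p.18 l.69–112] -/
theorem thm8_loopGain : Ginf * Kc = gam := by
  unfold Ginf Kc gam
  have hπ3 : 0 < Real.pi ^ 2 - 3 := by nlinarith [Real.pi_gt_three]
  have hπ : 0 < Real.pi := Real.pi_pos
  set a : ℝ := Real.pi ^ 2 - 3 with ha
  have hsa : 0 < Real.sqrt a := Real.sqrt_pos.2 hπ3
  have h32 : a ^ (3 / 2 : ℝ) = a * Real.sqrt a := by
    rw [show (3 / 2 : ℝ) = 1 + 1 / 2 by norm_num, Real.rpow_add hπ3, Real.rpow_one,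
      Real.sqrt_eq_rpow]
  have h12 : Real.sqrt (12 * a) = 2 * Real.sqrt 3 * Real.sqrt a := by
    rw [show (12 : ℝ) * a = (2 * Real.sqrt 3) ^ 2 * a by
      rw [mul_pow, Real.sq_sqrt (by norm_num : (0:ℝ) ≤ 3)]; norm_num]
    rw [Real.sqrt_mul (by positivity), Real.sqrt_sq (by positivity)]
  rw [h32, h12]
  have hs3 : 0 < Real.sqrt 3 := Real.sqrt_pos.2 (by norm_num)
  field_simp

/-! ## The Steps of the printed argument (nothing asserted; `per` = the torus of the paper) -/

/-- **Step — Lemma 2 (Energy dissipation) (22) p.7 l.102–109** «dE/dt = −νΩ(t) ≤ 0. In particular,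
E(t) ≤ E(0)», typed as the consequence Thm 13 (3) consumes: along every class solution on `[0,T)`,
`E(t) ≤ E(0)`. Classical; TRUE-type (not discharged). [claim: Wayman2026, status: under-review]
[cite: Wayman2026, Lemma 2 (22) p.7 l.102–109] -/
def Step_L2 : Prop :=
  ∀ (ν T : ℝ) (u₀ : E3 → E3) (u : ℝ → E3 → E3) (p : ℝ → E3 → ℝ), 0 < ν → IsSol per ν T u₀ u p →
    ∀ t ∈ Ico 0 T, En per (u t) ≤ En per u₀

/-- **Step — Prop 4 (Enstrophy equation) (26) p.8 l.62–67** «dΩ/dt = −2νP(t) + 2∫_{T³} ω_iS_ijω_j d³x»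
along every class solution at interior times. Classical; TRUE-type (not discharged).
[claim: Wayman2026, status: under-review] [cite: Wayman2026, Prop 4 (26) p.8 l.62–67] -/
def Step_P4 : Prop :=
  ∀ (ν T : ℝ) (u₀ : E3 → E3) (u : ℝ → E3 → E3) (p : ℝ → E3 → ℝ), 0 < ν → IsSol per ν T u₀ u p →
    ∀ t ∈ Ioo 0 T,
      HasDerivAt (fun s => Ens per (u s)) (-(2 * ν * Pal per (u t)) + 2 * stretch per (u t)) t

/-- **Step — Prop 9 (Enstrophy-controlled sector bound) (44) p.16 l.9–26** «On T³(a*), the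
vortex-stretching integral satisfies |∫_{T³} ω_iS_ijω_j d³x| ≤ tanh³δ_h · ‖ω‖_{L∞} · Ω», for every
smooth divergence-free `per`-periodic field (the slices of class solutions). Typist's note: TRUE-type —
pointwise `|ω·Sω| ≤ √(2/3)|S|_F|ω|²` (traceless `S`) and `∫_{T³}|S|² = ½∫_{T³}|ω|²` give the
classical constant `1/√3 ≈ 0.5774 < tanh³δ_h ≈ 0.5807`; the printed triad-sum derivation (p.16 l.27–69,
Prop 8) is not needed for it. Not discharged here. [claim: Wayman2026, status: under-review]
[cite: Wayman2026, Prop 9 (44) p.16 l.9–26; Remark 7 p.16 l.70–80] -/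
def Step_P9 : Prop :=
  ∀ v : E3 → E3, ContDiff ℝ ∞ v → VectorCalculus.IsDivFree v → IsPer per v →
    |stretch per v| ≤ Kc * supN (curl v) * Ens per v

/-- **Step — Thm 7 (Enstrophy estimate) (48) p.17 l.47–55** «On T³(a*) with any smooth divergence-free
initial data u₀ and any ν > 0, the enstrophy satisfies dΩ/dt ≤ −2νP + 2tanh³δ_h‖ω‖_{L∞}Ω» (proof p.18
l.2–7 = (26) + (44)), along every class solution at interior times. TRUE-type;
`thm7_of_steps : Step_P4 → Step_P9 → Step_T7` PROVED. [claim: Wayman2026, status: under-review]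
[cite: Wayman2026, Thm 7 (48) p.17 l.47–55; proof p.18 l.2–7] -/
def Step_T7 : Prop :=
  ∀ (ν T : ℝ) (u₀ : E3 → E3) (u : ℝ → E3 → E3) (p : ℝ → E3 → ℝ), 0 < ν → IsSol per ν T u₀ u p →
    ∀ t ∈ Ioo 0 T, ∃ D : ℝ, HasDerivAt (fun s => Ens per (u s)) D t ∧
      D ≤ -(2 * ν * Pal per (u t)) + 2 * Kc * supN (curl (u t)) * Ens per (u t)

/-- **Step — Thm 9 (Continuous-time absolute stability) (53) p.21 l.2–17** (= p.3 l.4–7; = Thm 13 (2)):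
«The loop gain γ = ‖G‖_{H∞}·tanh³δ_h ≈ 0.631 < 1 (Theorem 8) implies: for every smooth divergence-free
u₀ on T³(a*), the peak vorticity decays geometrically at stroboscopic times:
‖ω(kτ)‖_{L∞} ≤ ‖ω₀‖_{L∞}γ^k, k = 0, 1, 2, …» — along every class solution on `[0,T)` from the datum,
at every stroboscopic time `kτ < T`, for EVERY `ν > 0`. The first display of the chain asserting a
datum- and `ν`-uniform decay (consumed by Thm 11 Step 2 (2a) p.27 l.22–25 and by Thm 13 (2) p.31
l.18–20). Typist's flag: SUSPICIOUS — see the module docstring (Stokes eigenmode, small `ν`).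
[claim: Wayman2026, status: under-review] [cite: Wayman2026, Thm 9 (53) p.21 l.2–17; p.3 l.4–7] -/
def Step_T9 : Prop :=
  ∀ (ν T : ℝ) (u₀ : E3 → E3) (u : ℝ → E3 → E3) (p : ℝ → E3 → ℝ), 0 < ν → IsSol per ν T u₀ u p →
    ∀ k : ℕ, (k : ℝ) * tau < T → supN (curl (u ((k : ℝ) * tau))) ≤ supN (curl u₀) * gam ^ k

/-- **Alongside — Thm 9 Step 4, display (61) p.22 l.40–47** «At t = kτ (k ≥ 1), the mild solution (55)
iterated k times gives ‖ω(kτ)‖_{L∞} ≤ C_τ(ν)‖ω((k−1)τ)‖_{L²} + γ·‖ω((k−1)τ)‖_{L∞} … (61)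
‖ω(kτ)‖_{L∞} ≤ M_k + γ·‖ω((k−1)τ)‖_{L∞}, M_k := C_τ(ν)·‖ω((k−1)τ)‖_{L²}» — `C_τ(ν)` from (59) p.22
l.33–39 (a constant of `ν` only), along every class solution. The printed origin of the γ-recursion.
[claim: Wayman2026, status: under-review] [cite: Wayman2026, Thm 9 Step 4 (58)–(61) p.22 l.19–47] -/
def Step_T9_61 : Prop :=
  ∀ ν : ℝ, 0 < ν → ∃ Cτ : ℝ, 0 ≤ Cτ ∧
    ∀ (T : ℝ) (u₀ : E3 → E3) (u : ℝ → E3 → E3) (p : ℝ → E3 → ℝ), IsSol per ν T u₀ u p →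
      ∀ k : ℕ, 1 ≤ k → (k : ℝ) * tau < T →
        supN (curl (u ((k : ℝ) * tau))) ≤
          Cτ * l2N per (curl (u (((k : ℝ) - 1) * tau))) + gam * supN (curl (u (((k : ℝ) - 1) * tau)))

/-- Global existence on `T³(a*)` (the conclusion «Hence T* = ∞» of Thm 9 Step 5 Stage 1 p.22 l.59 and of
Thm 11 p.26): every datum launches a global Clay-sense solution. [claim: Wayman2026, status: under-review]
[cite: Wayman2026, Thm 9 Step 5 p.22 l.49–59; Thm 11 p.26 l.43–70] -/
def GlobalExistence : Prop :=
  ∀ ν : ℝ, 0 < ν → ∀ u₀ : E3 → E3, IsDatum per u₀ →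
    ∃ (u : ℝ → E3 → E3) (p : ℝ → E3 → ℝ), IsGlobalSol per ν u₀ u p

/-- **Alongside — Thm 9 Step 5, Stage 1 p.22 l.49–59** «If T* < ∞, there are only finitely many
stroboscopic times kτ < T*, and each M_k < ∞. Iterating (61): sup_{kτ<T*}‖ω(kτ)‖_{L∞} =: B < ∞.
Parabolic regularity on each interval [kτ,(k+1)τ] then gives sup_{[0,T*)}‖ω‖_{L∞} ≤ C(B,ν) < ∞ …
contradicting the BKM blowup criterion (71). Hence T* = ∞» — typed as the implication the passage
asserts: the recursion (61) yields global existence. Typist's flag: SUSPICIOUS as an inference (between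
stroboscopic times the sup is not controlled by the endpoint values). [claim: Wayman2026, status: under-review]
[cite: Wayman2026, Thm 9 Step 5 Stage 1 p.22 l.49–59] -/
def Step_T9_stage1 : Prop :=
  Step_T9_61 → GlobalExistence

/-- **Step — Corollary 1 (Discrete stability from continuous) (65) p.23 l.30–43** (Closure B):
«‖ω[k]‖_{L∞} ≤ Cγ^k ∀ k ≥ 0», `ω[k] = ω(kτ)`, `C` per datum (and `ν`), along every class solution.
[claim: Wayman2026, status: under-review] [cite: Wayman2026, Cor 1 (65) p.23 l.30–43] -/
def Step_C1 : Prop :=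
  ∀ ν : ℝ, 0 < ν → ∀ u₀ : E3 → E3, IsDatum per u₀ → ∃ C : ℝ,
    ∀ (T : ℝ) (u : ℝ → E3 → E3) (p : ℝ → E3 → ℝ), IsSol per ν T u₀ u p →
      ∀ k : ℕ, (k : ℝ) * tau < T → supN (curl (u ((k : ℝ) * tau))) ≤ C * gam ^ k

/-- **Step — Thm 10 (Stroboscopic contraction) (67) p.24 l.4–23** (Closure C): «there exists a constant
M₀ < ∞ depending on ‖u₀‖_{H²} and ν such that … ‖ω(kτ)‖_{L∞} ≤ γ^k‖ω₀‖_{L∞} + M₀/(1−γ) … for all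
k ≥ 0», along every class solution. An a priori sup-vorticity bound at stroboscopic times ((B)-strength
face). [claim: Wayman2026, status: under-review] [cite: Wayman2026, Thm 10 (67) p.24 l.4–23] -/
def Step_T10 : Prop :=
  ∀ ν : ℝ, 0 < ν → ∀ u₀ : E3 → E3, IsDatum per u₀ → ∃ M₀ : ℝ, 0 ≤ M₀ ∧
    ∀ (T : ℝ) (u : ℝ → E3 → E3) (p : ℝ → E3 → ℝ), IsSol per ν T u₀ u p →
      ∀ k : ℕ, (k : ℝ) * tau < T →
        supN (curl (u ((k : ℝ) * tau))) ≤ gam ^ k * supN (curl u₀) + M₀ / (1 - gam)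

/-- The a priori face Thm 11 Step 1 consumes: along every class solution on every slab `[0,T)` the peak
vorticity is bounded («∫₀^{T*}‖ω‖_{L∞} = ∞» being the only obstruction, (71) p.27 l.9–12).
[claim: Wayman2026, status: under-review] [cite: Wayman2026, Thm 11 Step 1 (71) p.27 l.4–12] -/
def VortBound : Prop :=
  ∀ ν : ℝ, 0 < ν → ∀ u₀ : E3 → E3, IsDatum per u₀ →
    ∀ (T : ℝ) (u : ℝ → E3 → E3) (p : ℝ → E3 → ℝ), IsSol per ν T u₀ u p →
      ∃ B : ℝ, ∀ t ∈ Ico 0 T, supN (curl (u t)) ≤ B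

/-- **Step — Thm 11 Step 1 p.27 l.4–12** «By the Fujita–Kato theorem [3], for smooth u₀ on T³(a*) there
exists T* > 0 and a unique smooth solution on [0,T*). If T* < ∞, then by the Beale–Kato–Majda criterion
[7]: ∫₀^{T*}‖ω(·,t)‖_{L∞} dt = ∞ (71)» — typed as the continuation it delivers: an a priori
sup-vorticity bound on every slab gives a global Clay-sense solution. Classical (torus local theory + BKM;
tree `Torus.classicalNS_continuation_of_vorticityBound` on `ℝ³/ℤ³`); TRUE-type (not discharged on the
`per`-periodic rendering). [claim: Wayman2026, status: under-review] [cite: Wayman2026, Thm 11 Step 1 (71) p.27 l.4–12] -/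
def Step11_1 : Prop :=
  VortBound → GlobalExistence

/-- **Step — Thm 11 Step 2 (72) p.27 l.13–32** «Geometric decay of stroboscopic vorticity …
‖ω[k]‖_{L∞} ≤ Cγ^k, k = 0, 1, 2, … (72) with … C < ∞ depending on ‖u₀‖_{H^s} (s > 3/2) and ν. Three
independent arguments: (2a) … Theorem 9 … (2b) … Corollary 1 … (2c) … Theorem 10», along every class
solution. Typist's flag: SUSPICIOUS (ν-uniform ratio γ; small-ν Stokes eigenmode).
[claim: Wayman2026, status: under-review] [cite: Wayman2026, Thm 11 Step 2 (72) p.27 l.13–32] -/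
def Step11_2 : Prop :=
  ∀ ν : ℝ, 0 < ν → ∀ u₀ : E3 → E3, IsDatum per u₀ → ∃ C : ℝ,
    ∀ (T : ℝ) (u : ℝ → E3 → E3) (p : ℝ → E3 → ℝ), IsSol per ν T u₀ u p →
      ∀ k : ℕ, (k : ℝ) * tau < T → supN (curl (u ((k : ℝ) * tau))) ≤ C * gam ^ k

/-- **Step — route (2c) p.27 l.29–32** «Duhamel contraction (Theorem 10): direct stroboscopic estimate
…» as a source of (72): typed as the implication the text asserts. Typist's flag: SUSPICIOUS ((67) carries
the non-decaying term `M₀/(1−γ)`). [claim: Wayman2026, status: under-review] [cite: Wayman2026, Thm 11 Step 2 (2c) p.27 l.29–32] -/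
def Step11_2c : Prop :=
  Step_T10 → Step11_2

/-- **Alongside — Thm 11 Step 3, interval display p.27 l.43–49** «On each interval [kτ,(k+1)τ], the
Duhamel formula with initial data ω(kτ) gives, for t ∈ [kτ,(k+1)τ]:
‖ω(t)‖_{L∞} ≤ e^{−νλ₁(t−kτ)}‖ω(kτ)‖_{L∞} + γ · sup_{s∈[kτ,t]}‖ω(s)‖_{L∞}», along every class solution,
every `k`, every `ν > 0` (datum-free `γ`). [claim: Wayman2026, status: under-review]
[cite: Wayman2026, Thm 11 Step 3 p.27 l.43–49] -/
def Step11_3_interval : Prop :=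
  ∀ (ν T : ℝ) (u₀ : E3 → E3) (u : ℝ → E3 → E3) (p : ℝ → E3 → ℝ), 0 < ν → IsSol per ν T u₀ u p →
    ∀ k : ℕ, ∀ t ∈ Ico 0 T, (k : ℝ) * tau ≤ t → t ≤ ((k : ℝ) + 1) * tau →
      supN (curl (u t)) ≤
        Real.exp (-(ν * lam1 * (t - (k : ℝ) * tau))) * supN (curl (u ((k : ℝ) * tau))) +
          gam * ⨆ s : Icc ((k : ℝ) * tau) t, supN (curl (u (s : ℝ)))

/-- **Step — Thm 11 Step 3 «BKM closure» (73)–(74) p.27 l.33–75** («Σ_k ‖ω[k]‖_{L∞}·τ ≤ τC Σγ^k =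
τC/(1−γ) < ∞ (73) … sup_{[kτ,(k+1)τ]}‖ω‖_{L∞} ≤ … (74) … ∫₀^∞‖ω‖_{L∞} dt ≤ τC/(1−γ)² < ∞. By BKM, the
solution is smooth for all t > 0»): typed as the implication the passage asserts — (72) and the interval
display give the a priori sup-vorticity bound on every slab. Typist's flag: SUSPICIOUS as an inference
(the interval sup is absorbed with the datum-free γ < 1). [claim: Wayman2026, status: under-review]
[cite: Wayman2026, Thm 11 Step 3 (73)–(74) p.27 l.33–75] -/
def Step11_3 : Prop :=
  Step11_2 → Step11_3_interval → VortBound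

/-- **Step — Thm 11 / Thm 13 (1), the word «unique»** (p.26 l.47; p.30 l.56): two global Clay-sense
solutions on `T³(a*)` from one datum have the same velocity. Classical (energy uniqueness of classical
periodic solutions; tree `Torus.IsClassicalNSSolutionOn.velocity_unique` on `ℝ³/ℤ³`); TRUE-type (not
discharged on the `per`-periodic rendering). [claim: Wayman2026, status: under-review]
[cite: Wayman2026, Thm 11 p.26 l.43–47; Thm 9 Step 1 p.21 l.20–21] -/
def Step11_unique : Prop :=
  ∀ ν : ℝ, 0 < ν → ∀ u₀ : E3 → E3, IsDatum per u₀ →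
    ∀ (u₁ : ℝ → E3 → E3) (p₁ : ℝ → E3 → ℝ) (u₂ : ℝ → E3 → E3) (p₂ : ℝ → E3 → ℝ),
      IsGlobalSol per ν u₀ u₁ p₁ → IsGlobalSol per ν u₀ u₂ p₂ → ∀ t : ℝ, 0 ≤ t → u₁ t = u₂ t

/-- **Step — Prop 14 p.31 l.26–90, the rescaling (79)** «y = (2πa*/L)x, s = (2πa*/L)²t, v(y,s) =
(L/(2πa*))u(…) … with the same viscosity ν … Inverting the rescaling (79) gives global regularity of u on
T³(L)»: Theorem 13 on `T³(a*)` gives Theorem 13 on every cubic torus. Typed as the implication the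
proposition asserts; classical Leray scaling (tree `ClayVariants.clayPeriodic_solvable_nsRescaleData_iff`);
TRUE-type (not discharged in this generality — `clay_of_thm13_1` below proves the Clay-relevant instance).
[claim: Wayman2026, status: under-review] [cite: Wayman2026, Prop 14 (79) p.31 l.26–90] -/
def Step_Prop14 : Prop :=
  ClaimedTheorem → ClaimedCubic

/-! ## Kernel relations (pure logic and the Clay doors) -/

/-- A global Clay-sense solution restricts to a class solution on every slab `[0,T)`, `T > 0`.
[cite: Wayman2026, Thm 11 Step 1 p.27 l.4–8] -/
theorem isSol_of_isGlobalSol {L ν T : ℝ} {u₀ : E3 → E3} {u : ℝ → E3 → E3} {p : ℝ → E3 → ℝ}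
    (hT : 0 < T) (hd : IsDatum L u₀) (h : IsGlobalSol L ν u₀ u p) : IsSol L ν T u₀ u p := by
  obtain ⟨hu, hp, hns, hperU, hperP⟩ := h
  refine ⟨hd, ?_, hns.initial, fun t ht => hperU t ht.1, fun t ht => hperP t ht.1⟩
  exact (hns.isClassicalNSSolutionOn_Icc hu hp hT).mono Ico_subset_Icc_self (uniqueDiffOn_Ico 0 T)

/-- **Thm 7 from Prop 4 and Prop 9** (proof p.18 l.2–7 «Substituting the sector bound (44) into the
enstrophy equation (26)»): PROVED bookkeeping (slices of class solutions are smooth, divergence free and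
`per`-periodic). [cite: Wayman2026, Thm 7 proof p.18 l.2–7] -/
theorem thm7_of_steps (h4 : Step_P4) (h9 : Step_P9) : Step_T7 := by
  intro ν T u₀ u p hν hS t ht
  refine ⟨_, h4 ν T u₀ u p hν hS t ht, ?_⟩
  have htI : t ∈ Ico 0 T := ⟨ht.1.le, ht.2⟩
  have hb := h9 (u t) (hS.classical.contDiff_velocity htI) (hS.classical.divFree t htI) (hS.perU t htI)
  have hle : stretch per (u t) ≤ Kc * supN (curl (u t)) * Ens per (u t) := (le_abs_self _).trans hb
  linarith

/-- **(72) from Thm 9** (route (2a) p.27 l.22–25): PROVED, `C := ‖ω₀‖_{L∞}`. [cite: Wayman2026, Thm 11 Step 2 (2a) p.27 l.22–25] -/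
theorem step11_2_of_thm9 (h : Step_T9) : Step11_2 := by
  intro ν hν u₀ _hu₀
  exact ⟨supN (curl u₀), fun T u p hS k hk => h ν T u₀ u p hν hS k hk⟩

/-- **(72) from Cor 1** (route (2b) p.27 l.26–28): PROVED (same shape). [cite: Wayman2026, Thm 11 Step 2 (2b) p.27 l.26–28] -/
theorem step11_2_of_cor1 (h : Step_C1) : Step11_2 := h

/-- **Global existence from Steps 1–3 of Thm 11** (p.27): PROVED, pure logic. [cite: Wayman2026, Thm 11 proof p.27 l.2–75] -/
theorem globalExistence_of_steps (h1 : Step11_1) (h2 : Step11_2) (hI : Step11_3_interval)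
    (h3 : Step11_3) : GlobalExistence :=
  h1 (h3 h2 hI)

/-- **Thm 13 (1) from global existence and the uniqueness word.** [cite: Wayman2026, Thm 13 proof p.31 l.18–19] -/
theorem thm13_1_of_steps (hE : GlobalExistence) (hU : Step11_unique) : Thm13_1 per :=
  fun ν hν u₀ hu₀ => ⟨hE ν hν u₀ hu₀, hU ν hν u₀ hu₀⟩

/-- **Thm 13 (2) from Thm 9** («Part (2) combines the loop gain γ < 1 (Theorem 8) with the geometric decay
(72)», p.31 l.19–20; Thm 9's display is Part (2) verbatim): PROVED — a global Clay-sense solution is a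
class solution on `[0, kτ + 1)`. [cite: Wayman2026, Thm 13 proof p.31 l.19–20; Thm 9 (53) p.21] -/
theorem thm13_2_of_thm9 (h : Step_T9) : Thm13_2 per tau := by
  intro ν hν u₀ hu₀ u p hG k
  have hT : 0 < (k : ℝ) * tau + 1 := by
    have : 0 ≤ (k : ℝ) * tau := by unfold tau; positivity
    linarith
  exact h ν _ u₀ u p hν (isSol_of_isGlobalSol hT hu₀ hG) k (by linarith)

/-- **Thm 13 (3) from Lemma 2** («Part (3) is Lemma 2», p.31 l.20): PROVED. [cite: Wayman2026, Thm 13 proof p.31 l.20] -/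
theorem thm13_3_of_lemma2 (h : Step_L2) : Thm13_3 per := by
  intro ν hν u₀ hu₀ u p hG t ht
  have hG' := hG
  obtain ⟨-, -, hns, -, -⟩ := hG'
  have h1 := h ν (t + 1) u₀ u p hν (isSol_of_isGlobalSol (by linarith) hu₀ hG) t ⟨ht, by linarith⟩
  exact h1

/-- **COMPOSITION — the printed logic composes** (Thm 13 proof p.31 l.18–20 over Thm 11's proof p.27):
Step 1 (Fujita–Kato + BKM), Thm 9 (route (2a) to (72)), the interval display and the BKM closure
(Step 3), the uniqueness word, and Lemma 2 give the three parts of Thm 13 on `T³(a*)`. PROVED, pure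
logic; nothing asserted. [cite: Wayman2026, Thm 13 proof p.31 l.18–20; Thm 11 proof p.27] -/
theorem claim_of_steps (h1 : Step11_1) (h9 : Step_T9) (hI : Step11_3_interval) (h3 : Step11_3)
    (hU : Step11_unique) (hL2 : Step_L2) : ClaimedTheorem :=
  ⟨thm13_1_of_steps (globalExistence_of_steps h1 (step11_2_of_thm9 h9) hI h3) hU,
    thm13_2_of_thm9 h9, thm13_3_of_lemma2 hL2⟩

/-- The same composition through route (2b) (Cor 1) for Part (1), Thm 9 still carrying Part (2).
[cite: Wayman2026, Thm 11 Step 2 (2b) p.27 l.26–28] -/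
theorem claim_of_steps_routeB (h1 : Step11_1) (hC : Step_C1) (h9 : Step_T9) (hI : Step11_3_interval)
    (h3 : Step11_3) (hU : Step11_unique) (hL2 : Step_L2) : ClaimedTheorem :=
  ⟨thm13_1_of_steps (globalExistence_of_steps h1 (step11_2_of_cor1 hC) hI h3) hU,
    thm13_2_of_thm9 h9, thm13_3_of_lemma2 hL2⟩

/-- `1`-periodicity in the sense of `IsPer 1` is Fefferman's `ℤ³`-periodicity. [folklore] -/
private theorem isPer_one_iff {X : Type*} (v : E3 → X) : IsPer 1 v ↔ IsLatticePeriodic v := by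
  simp [IsPer, IsLatticePeriodic, one_smul]

/-- **Clay link from Prop 14** (the printed claim includes the unit cubic torus): PROVED — at `L = 1` the
existence half of Thm 13 (1) is Fefferman's (B) with `f ≡ 0`, velocity slices `ℤ³`-periodic.
[cite: Wayman2026, Prop 14 p.31 l.21–25] [cite: FeffermanClay2006, (B) with (8) (10) (11) p.2] -/
theorem clay_of_cubic (h : ClaimedCubic) : clayPeriodic.Regularity := by
  intro ν hν u₀ hs hd hper
  obtain ⟨h1, -, -⟩ := h 1 one_pos
  obtain ⟨⟨u, p, hu, hp, hns, hperU, -⟩, -⟩ := h1 ν hν u₀ ⟨hs, hd, (isPer_one_iff u₀).2 hper⟩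
  exact ⟨u, p, hu, hp, hns, fun t ht => (isPer_one_iff (u t)).1 (hperU t ht)⟩

/-- The printed datum rescaled to period `1`… conversely, a `ℤ³`-periodic datum blown up to period `per`:
`x ↦ per⁻¹ • u₀ (per⁻¹ • x)` is `per`-periodic. [cite: Wayman2026, Prop 14 (79) p.31 l.26–45] -/
private theorem isPer_nsRescaleData_inv {u₀ : E3 → E3} (h : IsLatticePeriodic u₀) {L : ℝ} (hL : L ≠ 0) :
    IsPer L (nsRescaleData L⁻¹ u₀) := by
  intro j x
  show L⁻¹ • u₀ (L⁻¹ • (x + L • EuclideanSpace.single j 1)) = L⁻¹ • u₀ (L⁻¹ • x)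
  rw [smul_add, smul_smul, inv_mul_cancel₀ hL, one_smul, h j]

/-- `per > 0` (private helper). [folklore] -/
private theorem per_pos : 0 < per := by
  unfold per aStar; positivity

/-- **Clay link from Thm 13 (1) itself through Leray's period scaling** (the substance of Prop 14 at
`L = 1`, by the tree's bridge `clayPeriodic_solvable_nsRescaleData_iff`): a `ℤ³`-periodic smooth
divergence-free datum `u₀` is the rescaling `nsRescaleData per w₀` of the `per`-periodic datum
`w₀ = nsRescaleData per⁻¹ u₀`; Thm 13 (1) solves the problem for `w₀` with `per`-periodic velocity
slices, and the bridge rescales the solution back. PROVED — Δ1 is no delta in substance.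
[cite: Wayman2026, Thm 13 (1) p.30–31; Prop 14 p.31] [cite: Tao2013Localisation, Rem. 1.2] [cite: FeffermanClay2006, (B) p.2] -/
theorem clay_of_thm13_1 (h : Thm13_1 per) : clayPeriodic.Regularity := by
  intro ν hν u₀ hs hd hper
  have hL : per ≠ 0 := per_pos.ne'
  set w₀ : E3 → E3 := nsRescaleData per⁻¹ u₀ with hw₀
  have hdat : nsRescaleData per w₀ = u₀ := by
    rw [hw₀, ← nsRescaleData_mul, inv_mul_cancel₀ hL, nsRescaleData_one]
  have hws : ContDiff ℝ ∞ w₀ := by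
    have : w₀ = fun x => per⁻¹ • u₀ (per⁻¹ • x) := rfl
    rw [this]
    exact (hs.comp (contDiff_const_smul _)).const_smul _
  have hwd : NSWave0.IsDivFree w₀ := by
    have hw : w₀ = fun x => per⁻¹ • (fun y => u₀ (per⁻¹ • y)) x := rfl
    rw [hw]
    exact VectorCalculus.IsDivFree.const_smul
      ((hs.differentiable (by simp)).comp (differentiable_id.const_smul per⁻¹))
      (VectorCalculus.IsDivFree.comp_smul hd per⁻¹) per⁻¹
  obtain ⟨⟨u, p, hu, hp, hns, hperU, -⟩, -⟩ :=
    h ν hν w₀ ⟨hws, hwd, isPer_nsRescaleData_inv hper hL⟩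
  rw [← hdat]
  exact (clayPeriodic_solvable_nsRescaleData_iff per_pos ν w₀).2
    ⟨u, p, hu, hp, hns, fun t ht j x => hperU t ht j x⟩

/-- **Clay link**: the claimed theorem implies Clay (B) — PROVED (through `clay_of_thm13_1`; the decay and
energy parts are not needed). [cite: Wayman2026, Thm 13 p.30–31; p.2 l.17 «We address the periodic case»] [cite: FeffermanClay2006, (B) p.2] -/
theorem clay_of_claimed (h : ClaimedTheorem) : clayPeriodic.Regularity :=
  clay_of_thm13_1 h.1

/-- With the steps, the printed chain would settle Clay (B). [cite: Wayman2026, Thm 13 proof p.31 l.18–20] [cite: FeffermanClay2006, (B) p.2] -/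
theorem clay_of_steps (h1 : Step11_1) (h9 : Step_T9) (hI : Step11_3_interval) (h3 : Step11_3)
    (hU : Step11_unique) (hL2 : Step_L2) : clayPeriodic.Regularity :=
  clay_of_claimed (claim_of_steps h1 h9 hI h3 hU hL2)

/-! ## REV 2 (additive, REF-2 WANT 11:32:02Z): Prop 8 (38) with Γ (36) and κ (37) at the literal triad grain

ALONGSIDE record (not a binder of `claim_of_steps`: the chain consumes (38) only through the number `Kc`;
REF-2 11:32:02Z «SLIP-class preliminary … the chain survives it with 1/√3»). Real polarization vectors;
the factor `i/a*` of (36) and the `−i a*` of the Biot–Savart relation cancel in `|Γ|` («leaving the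
coupling coefficient independent of the modulus a* for the angular part», p.13 l.12–14). -/

/-- A lattice wavevector: integer coordinates, nonzero (the Fourier modes `n ∈ ℤ³ ∖ {0}`, Def 6 p.7
l.27–43; (36) p.13). [cite: Wayman2026, Def 6 p.7 l.27–43; Lemma 3 (35)–(36) p.12 l.56 – p.13 l.14] -/
def IsMode (n : E3) : Prop :=
  (∀ i, ∃ z : ℤ, n i = (z : ℝ)) ∧ n ≠ 0

/-- A resonant triad «n₁ + n₂ + n₃ = 0» of modes (Lemma 3 p.12 l.56–67; p.13 l.2–4 «the sum is over resonant
triads in ℤ³ ∖ {0}»). [cite: Wayman2026, Lemma 3 (35) p.12 l.56–67; p.13 l.2–4] -/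
def IsTriad (n₁ n₂ n₃ : E3) : Prop :=
  IsMode n₁ ∧ IsMode n₂ ∧ IsMode n₃ ∧ n₁ + n₂ + n₃ = 0

/-- An admissible (transverse, nonzero) vorticity polarization of mode `n`: `n · ω̂_n = 0` (from
`ω̂_n = (in/a*) × û_n`, Prop 6 (b) p.10 l.33–35; divergence-free). [cite: Wayman2026, Prop 6 (b) p.10 l.33–38; Def 10 (37) p.13 l.47–57] -/
def IsPolar (n w : E3) : Prop :=
  w ≠ 0 ∧ ⟪n, w⟫ = 0

/-- **The normalized angular coupling κ (37) of a triad, with Γ from (36)** p.13 l.2–14, l.47–57: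
«Γ(n₁,n₂,n₃) = (i/a*)(ω̂_{n₁}·n₂)(ω̂_{n₃}·û_{n₂})» with «û_n = −i a*(n × ω̂_n)/|n|²», and
«κ(n₁,n₂,n₃) := |Γ(n₁,n₂,n₃)| / (|ω̂_{n₁}||ω̂_{n₂}||ω̂_{n₃}|)», i.e.
`κ = |ω̂₁·n₂|·|ω̂₃·(n₂ × ω̂₂)| / (|n₂|²|ω̂₁||ω̂₂||ω̂₃|)` (the moduli `a*` cancel). Real polarizations.
[cite: Wayman2026, Lemma 3 (36) p.13 l.2–14; Def 10 (37) p.13 l.47–57] -/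
def kappa (n₂ w₁ w₂ w₃ : E3) : ℝ :=
  |⟪w₁, n₂⟫| * |⟪w₃, cross n₂ w₂⟫| / (‖n₂‖ ^ 2 * ‖w₁‖ * ‖w₂‖ * ‖w₃‖)

/-- **Prop 8 (Trivector projection bound) (38) p.13 l.58–72, the «≤» half**: «On T³(a*), the normalized
angular coupling of every resonant triad satisfies sup_triads κ(n₁,n₂,n₃) = tanh³δ_h = √(π²−3)³/π³ ≈
0.5807 < 1» — every resonant transverse triad has `κ ≤ Kc`. ALONGSIDE (the chain uses (38) only
through `Kc` in `Step_P9`/`Step_T7`; REF-2: slip-class preliminary). [claim: Wayman2026, status: under-review]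
[cite: Wayman2026, Prop 8 (38) p.13 l.58–72; proof p.14 l.1 – p.16 l.8] -/
def Step_P8_le : Prop :=
  ∀ n₁ n₂ n₃ w₁ w₂ w₃ : E3, IsTriad n₁ n₂ n₃ → IsPolar n₁ w₁ → IsPolar n₂ w₂ → IsPolar n₃ w₃ →
    kappa n₂ w₁ w₂ w₃ ≤ Kc

/-- **Prop 8 (38), as printed («sup … = tanh³δ_h»)**: the «≤» half together with attainment of the
supremum value `Kc` up to every `ε > 0` (Lemma 5 «Saturation» p.15 l.83 prints an attaining triad).
ALONGSIDE. [claim: Wayman2026, status: under-review] [cite: Wayman2026, Prop 8 (38) p.13 l.58–72; Lemma 5 p.15 l.83] -/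
def Step_P8 : Prop :=
  Step_P8_le ∧
    ∀ ε : ℝ, 0 < ε → ∃ n₁ n₂ n₃ w₁ w₂ w₃ : E3, IsTriad n₁ n₂ n₃ ∧ IsPolar n₁ w₁ ∧ IsPolar n₂ w₂ ∧
      IsPolar n₃ w₃ ∧ Kc - ε < kappa n₂ w₁ w₂ w₃

/-- The printed equality face gives the inequality face. [cite: Wayman2026, Prop 8 (38) p.13] -/
theorem stepP8_le_of_stepP8 (h : Step_P8) : Step_P8_le := h.1


/-! ## APPENDIX (ns-claims-lit-3 g8, 2026-08-27; D-0026 post-VERDICT TRUE-column discharges, append-only):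
## Prop 9 (44) p.16 is TRUE — kernel proof of `Step_P9` with the sharp classical constant `1/√3 ≤ tanh³δ_h`;
## Lemma 2 (22) p.7 is TRUE — kernel proof of `Step_L2` (energy decay), hence Thm 13 (3) (`thm13_3_holds`)
## (rev 4) Thm 11 Step 1 p.27 and the uniqueness word p.26 are TRUE — `Step11_1`, `Step11_unique`
## (rev 5) Prop 4 (26) p.8 and Thm 7 (48) p.17 are TRUE — `step_P4_holds`, `step_T7_holds`
## (rev 6) Thm 11 Step 3 «BKM closure» p.27 is TRUE as typed — `step11_3_holds`; `gam_lt_one`; `claim_of_T9_interval`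

Nothing above this block is changed; no Step is asserted. The token of record (#C154: `Step_T9`, kit
`…Theorems.Wayman2026.not_Step_T9` p530351) is untouched; `Step_P9` is ALONGSIDE/TRUE. The proof: for a
trace-free velocity gradient `D` with symmetric part `S`, `|ω·Dω| = |ω·Sω| ≤ √(2/3)·|S|_F·|ω|²`
(Cauchy–Schwarz in the Frobenius product against the trace-free tensor `ω⊗ω − ⅓|ω|²I`); Cauchy–Schwarz on
the period cell; Miller's identity `∫_{𝕋³}|S|² = ½∫_{𝕋³}|ω|²` (tree
`integral_strainNormSq_eq_half_integral_torusVorticitySqAt`, transported between the `ℝ³` period cell and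
`𝕋³` by `Torus.integral_eq_integral_lift_holds` and Leray's rescaling `per ↦ 1`); hence
`|∫ω·Sω| ≤ (1/√3)‖ω‖_{L∞}Ω ≤ tanh³δ_h‖ω‖_{L∞}Ω` since `1/√3 ≈ 0.5774 ≤ (π²−3)^{3/2}/π³ ≈ 0.5807`
(`inv_sqrt_three_le_Kc`, from `π > 3.14`). REF-2 11:32:02Z: «the chain survives it with 1/√3».
[cite: Wayman2026, Prop 9 (44) p.16 l.9–26; Remark 7 p.16 l.70–80] [cite: Miller2019, Prop. 3.1] -/

section PropNine

open Literature.Analysis.FunctionSpaces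
open scoped Pointwise


/-- Matrix entries `Dᵢⱼ = (D eⱼ)ᵢ` of an operator on `ℝ³`. [folklore] -/
def ent (D : E3 →L[ℝ] E3) (i j : Fin 3) : ℝ := D (EuclideanSpace.single j 1) i

/-- Entries of the symmetric part `Sᵢⱼ = ½(Dᵢⱼ + Dⱼᵢ)`. [folklore] -/
def symEnt (D : E3 →L[ℝ] E3) (i j : Fin 3) : ℝ := (ent D i j + ent D j i) / 2

/-- `Σᵢⱼ Sᵢⱼ²`. [folklore] -/
def symNormSq (D : E3 →L[ℝ] E3) : ℝ := ∑ i, ∑ j, symEnt D i j ^ 2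

/-! ### §B1 The cell `[0,L)³` -/

/-- The period cell `[0,L)³` is measurable. [folklore] -/
private theorem measurableSet_cell (L : ℝ) : MeasurableSet (cell L) := by
  have h : cell L = ⋂ i, (fun y : E3 => y i) ⁻¹' Ico 0 L := by
    ext y; simp [cell]
  rw [h]
  exact MeasurableSet.iInter fun i => measurableSet_Ico.preimage (EuclideanSpace.proj i).continuous.measurable

/-- Points of `[0,L)³` have norm `≤ √3·L`. [folklore] -/
private theorem norm_le_of_mem_cell {L : ℝ} (hL : 0 ≤ L) {x : E3} (hx : x ∈ cell L) : ‖x‖ ≤ Real.sqrt 3 * L := by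
  rw [EuclideanSpace.norm_eq]
  have h : ∑ i, ‖x i‖ ^ 2 ≤ 3 * L ^ 2 := by
    calc ∑ i, ‖x i‖ ^ 2 ≤ ∑ _i : Fin 3, L ^ 2 := Finset.sum_le_sum fun i _ => by
            have hi := hx i
            rw [Real.norm_eq_abs, sq_abs]
            nlinarith [hi.1, hi.2]
      _ = 3 * L ^ 2 := by simp
  calc Real.sqrt (∑ i, ‖x i‖ ^ 2) ≤ Real.sqrt (3 * L ^ 2) := Real.sqrt_le_sqrt h
    _ = Real.sqrt 3 * L := by rw [Real.sqrt_mul (by norm_num), Real.sqrt_sq hL]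

/-- `[0,L)³` is bounded. [folklore] -/
private theorem isBounded_cell {L : ℝ} (hL : 0 ≤ L) : Bornology.IsBounded (cell L) :=
  (Metric.isBounded_closedBall (x := (0 : E3)) (r := Real.sqrt 3 * L)).subset fun _ hx =>
    mem_closedBall_zero_iff.2 (norm_le_of_mem_cell hL hx)

/-- Lebesgue measure restricted to `[0,L)³` is finite. [folklore] -/
private theorem isFiniteMeasure_restrict_cell {L : ℝ} (hL : 0 ≤ L) :
    IsFiniteMeasure (volume.restrict (cell L) : Measure E3) :=
  isFiniteMeasure_restrict.2 (isBounded_cell hL).measure_lt_top.ne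

/-- Continuous functions are integrable on `[0,L)³`. [folklore] -/
private theorem integrableOn_cell {L : ℝ} (hL : 0 ≤ L) {f : E3 → ℝ} (hf : Continuous f) :
    IntegrableOn f (cell L) volume :=
  (hf.continuousOn.integrableOn_compact (isBounded_cell hL).isCompact_closure).mono_set subset_closure

/-- `[0,L)³ = L • [0,1)³` for `L > 0`. [folklore] -/
private theorem cell_eq_smul_cell_one {L : ℝ} (hL : 0 < L) : cell L = L • cell 1 := by
  ext x
  rw [Set.mem_smul_set]
  constructor
  · intro hx
    refine ⟨L⁻¹ • x, fun i => ?_, by rw [smul_smul, mul_inv_cancel₀ hL.ne', one_smul]⟩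
    have hi := hx i
    rw [PiLp.smul_apply, smul_eq_mul]
    constructor
    · exact mul_nonneg (inv_nonneg.2 hL.le) hi.1
    · rw [inv_mul_lt_iff₀ hL]; simpa using hi.2
  · rintro ⟨y, hy, rfl⟩ i
    have hi := hy i
    rw [PiLp.smul_apply, smul_eq_mul]
    exact ⟨mul_nonneg hL.le hi.1, by nlinarith [hi.2]⟩

/-- `cell 1` is the tree's fundamental domain `Torus.unitCube`. [folklore] -/
private theorem cell_one_eq_unitCube : cell 1 = Torus.unitCube (Fin 3) := rfl

/-! ### §B2 Derivatives of translates and dilates -/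

/-- The gradient of an `L`-periodic field is `L`-periodic. [folklore] -/
private theorem fderiv_periodic {L : ℝ} {v : E3 → E3} (hper : IsPer L v) : IsPer L (fderiv ℝ v) := by
  intro j x
  have h : (fun y => v (y + L • EuclideanSpace.single j 1)) = v := funext fun y => hper j y
  show fderiv ℝ v (x + L • EuclideanSpace.single j 1) = fderiv ℝ v x
  rw [← fderiv_comp_add_right, h]

/-- The vorticity of an `L`-periodic field is `L`-periodic. [folklore] -/
private theorem curl_periodic {L : ℝ} {v : E3 → E3} (hper : IsPer L v) : IsPer L (curl v) := by
  intro j x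
  show curl v (x + L • EuclideanSpace.single j 1) = curl v x
  rw [curl_eq_curlCLM, curl_eq_curlCLM, fderiv_periodic hper j x]

/-- Chain rule for the dilate `y ↦ v(Ly)`: `D(v(L·))(y) = L·Dv(Ly)` (Mathlib `fderiv_comp_smul`). [folklore] -/
private theorem fderiv_comp_smul_eq (v : E3 → E3) (L : ℝ) (y : E3) :
    fderiv ℝ (fun z => v (L • z)) y = L • fderiv ℝ v (L • y) := by
  rw [fderiv_comp_smul]

/-- Entries of the gradient of a dilate scale by `L`. [folklore] -/
private theorem ent_fderiv_comp_smul (v : E3 → E3) (L : ℝ) (y : E3) (i j : Fin 3) :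
    ent (fderiv ℝ (fun z => v (L • z)) y) i j = L * ent (fderiv ℝ v (L • y)) i j := by
  rw [ent, ent, fderiv_comp_smul_eq]; simp

/-- `|S|²` of a dilate scales by `L²`. [folklore] -/
private theorem symNormSq_fderiv_comp_smul (v : E3 → E3) (L : ℝ) (y : E3) :
    symNormSq (fderiv ℝ (fun z => v (L • z)) y) = L ^ 2 * symNormSq (fderiv ℝ v (L • y)) := by
  simp only [symNormSq, symEnt, ent_fderiv_comp_smul, Finset.mul_sum]
  exact Finset.sum_congr rfl fun i _ => Finset.sum_congr rfl fun j _ => by ring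

/-- `curl (v(L·))(y) = L·(curl v)(Ly)`. [folklore] -/
private theorem curl_comp_smul' (v : E3 → E3) (L : ℝ) (y : E3) :
    curl (fun z => v (L • z)) y = L • curl v (L • y) := by
  rw [curl_eq_curlCLM, curl_eq_curlCLM, fderiv_comp_smul_eq, map_smul]

/-! ### §B3 `‖curl v‖²` in entries -/

/-- `|curl v|² = ½ Σᵢⱼ (∂ᵢvⱼ − ∂ⱼvᵢ)²` in gradient entries. [folklore] -/
private theorem norm_curl_sq_eq_half_sum (v : E3 → E3) (x : E3) :
    ‖curl v x‖ ^ 2 =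
      2⁻¹ * ∑ i, ∑ j, (ent (fderiv ℝ v x) j i - ent (fderiv ℝ v x) i j) ^ 2 := by
  rw [EuclideanSpace.norm_sq_eq]
  simp only [curl, ent, Fin.sum_univ_three, Real.norm_eq_abs, sq_abs]
  simp
  ring

/-! ### §B4 The torus identity on the unit cell, then on `[0,L)³` -/

/-- `∫_{[0,1)³} |S|² = ½ ∫_{[0,1)³} |ω|²` for a smooth divergence-free `ℤ³`-periodic field
(Miller 2019, Prop. 3.1 on `𝕋³`, through the tree's `integral_strainNormSq_eq_half_integral_torusVorticitySqAt`).
[cite: Miller2019, Prop. 3.1] -/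
theorem integral_symNormSq_eq_half_integral_curl_sq_one {w : E3 → E3} (hw : ContDiff ℝ ∞ w)
    (hdiv : VectorCalculus.IsDivFree w) (hper : IsLatticePeriodic w) :
    ∫ y in cell 1, symNormSq (fderiv ℝ w y) = 2⁻¹ * ∫ y in cell 1, ‖curl w y‖ ^ 2 := by
  set U : UnitAddTorus (Fin 3) → E3 := fun x => w (Torus.repr x) with hUdef
  have hlift : Torus.lift U = w := Torus.lift_descend_holds w hper
  have hU : Torus.IsSmooth U := by
    show ContDiff ℝ ∞ (Torus.lift U); rw [hlift]; exact hw
  have hU1 : Torus.IsContDiff 1 U := hU.isContDiff (by exact_mod_cast le_top)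
  have hD : ∀ (y : E3) (i j : Fin 3),
      Torus.partialDeriv j U (Torus.proj y) i = ent (fderiv ℝ w y) i j := by
    intro y i j
    rw [Torus.partialDeriv_eq_fderiv_apply hU1, ← Torus.fderiv_lift, hlift, ent]
  have hdivU : Torus.IsDivFree U := by
    refine (Torus.isDivFree_iff_trace_fderiv_lift hU1).2 fun y => ?_
    rw [hlift]
    exact hdiv y
  have key := integral_strainNormSq_eq_half_integral_torusVorticitySqAt hU hdivU
  rw [Torus.integral_eq_integral_lift_holds, Torus.integral_eq_integral_lift_holds] at key
  have h1 : (Torus.lift fun x => ∑ i, ∑ j,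
      ((Torus.partialDeriv j U x i + Torus.partialDeriv i U x j) / 2) ^ 2) =
      fun y => symNormSq (fderiv ℝ w y) := by
    funext y
    simp only [Torus.lift, Function.comp_apply, hD, symNormSq, symEnt]
  have h2 : Torus.lift (torusVorticitySqAt U) = fun y => ‖curl w y‖ ^ 2 := by
    funext y
    simp only [Torus.lift, Function.comp_apply, torusVorticitySqAt, hD, norm_curl_sq_eq_half_sum]
  rw [h1, h2] at key
  rw [cell_one_eq_unitCube]
  exact key

/-- `∫_{[0,L)³} |S|² = ½ ∫_{[0,L)³} |ω|²` for a smooth divergence-free `L`-periodic field, `L > 0`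
(rescaling of the unit-cell identity). [cite: Miller2019, Prop. 3.1] -/
theorem integral_symNormSq_eq_half_integral_curl_sq {L : ℝ} (hL : 0 < L) {v : E3 → E3}
    (hv : ContDiff ℝ ∞ v) (hdiv : VectorCalculus.IsDivFree v) (hper : IsPer L v) :
    ∫ x in cell L, symNormSq (fderiv ℝ v x) = 2⁻¹ * ∫ x in cell L, ‖curl v x‖ ^ 2 := by
  set w : E3 → E3 := fun y => v (L • y) with hwdef
  have hw : ContDiff ℝ ∞ w := hv.comp (contDiff_id.const_smul L)
  have hperw : IsLatticePeriodic w := by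
    have h := ClayVariants.isLatticePeriodic_smul_comp_smul (F := E3) hper (1 : ℝ)
    simpa only [one_smul] using h
  have hdivw : VectorCalculus.IsDivFree w := VectorCalculus.IsDivFree.comp_smul hdiv L
  have h1 := integral_symNormSq_eq_half_integral_curl_sq_one hw hdivw hperw
  have hS : (fun y => symNormSq (fderiv ℝ w y)) = fun y => L ^ 2 * symNormSq (fderiv ℝ v (L • y)) :=
    funext fun y => symNormSq_fderiv_comp_smul v L y
  have hC : (fun y => ‖curl w y‖ ^ 2) = fun y => L ^ 2 * ‖curl v (L • y)‖ ^ 2 := by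
    funext y
    rw [hwdef, curl_comp_smul', norm_smul, mul_pow, Real.norm_eq_abs, sq_abs]
  rw [hS, hC, integral_const_mul, integral_const_mul] at h1
  have hL2 : (L ^ 2 : ℝ) ≠ 0 := pow_ne_zero 2 hL.ne'
  have h2 : ∫ y in cell 1, symNormSq (fderiv ℝ v (L • y)) = 2⁻¹ * ∫ y in cell 1, ‖curl v (L • y)‖ ^ 2 := by
    have := h1
    field_simp at this
    linarith
  rw [Measure.setIntegral_comp_smul_of_pos volume (fun x => symNormSq (fderiv ℝ v x)) (cell 1) hL,
    Measure.setIntegral_comp_smul_of_pos volume (fun x => ‖curl v x‖ ^ 2) (cell 1) hL,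
    ← cell_eq_smul_cell_one hL, smul_eq_mul, smul_eq_mul] at h2
  have hLn : ((L ^ Module.finrank ℝ E3)⁻¹ : ℝ) ≠ 0 := inv_ne_zero (pow_ne_zero _ hL.ne')
  have := h2
  field_simp at this
  linarith

/-! ### §B5 Boundedness of the vorticity of a periodic smooth field -/

/-- A continuous `L`-periodic field on `ℝ³` is bounded (it factors through the compact torus). [folklore] -/
private theorem bddAbove_range_norm_of_periodic {L : ℝ} (hL : 0 < L) {g : E3 → E3} (hg : Continuous g)
    (hper : IsPer L g) : BddAbove (Set.range fun x => ‖g x‖) := by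
  set h : E3 → E3 := fun y => g (L • y) with hhdef
  have hh : Continuous h := hg.comp (continuous_id.const_smul L)
  have hperh : IsLatticePeriodic h := by
    have h' := ClayVariants.isLatticePeriodic_smul_comp_smul (F := E3) hper (1 : ℝ)
    simpa only [one_smul] using h'
  set U := Torus.descend h hperh with hU
  have hliftU : Torus.lift U = h := Torus.lift_descend_holds h hperh
  have hUc : Continuous U := Torus.continuous_lift_iff.1 (by rw [hliftU]; exact hh)
  obtain ⟨B, hB⟩ := (isCompact_range (continuous_norm.comp hUc)).bddAbove
  refine ⟨B, ?_⟩
  rintro _ ⟨x, rfl⟩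
  have hx : g x = Torus.lift U (L⁻¹ • x) := by
    rw [hliftU, hhdef]; simp [smul_smul, mul_inv_cancel₀ hL.ne']
  show ‖g x‖ ≤ B
  rw [hx]
  exact hB ⟨Torus.proj (L⁻¹ • x), rfl⟩

/-- `Σᵢⱼ Sᵢⱼ² ≥ 0`. [folklore] -/
private theorem symNormSq_nonneg (D : E3 →L[ℝ] E3) : 0 ≤ symNormSq D :=
  Finset.sum_nonneg fun _ _ => Finset.sum_nonneg fun _ _ => sq_nonneg _

/-- `(Dω)ᵢ = Σⱼ Dᵢⱼ ωⱼ`. [folklore] -/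
private theorem apply_eq_sum_ent (D : E3 →L[ℝ] E3) (w : E3) (i : Fin 3) :
    D w i = ∑ j, ent D i j * w j := by
  have hw : w = ∑ j, w j • EuclideanSpace.single j (1 : ℝ) := by
    simpa using ((EuclideanSpace.basisFun (Fin 3) ℝ).sum_repr w).symm
  conv_lhs => rw [hw]
  simp only [map_sum, map_smul, ent, WithLp.ofLp_sum, WithLp.ofLp_smul, Finset.sum_apply,
    Pi.smul_apply, smul_eq_mul]
  exact Finset.sum_congr rfl fun j _ => mul_comm _ _

/-- `⟪ω, Dω⟫ = Σᵢⱼ Dᵢⱼ ωᵢ ωⱼ`. [folklore] -/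
private theorem inner_apply_eq_sum_ent (D : E3 →L[ℝ] E3) (w : E3) :
    ⟪w, D w⟫ = ∑ i, ∑ j, ent D i j * (w i * w j) := by
  rw [PiLp.inner_apply]
  refine Finset.sum_congr rfl fun i _ => ?_
  simp only [RCLike.inner_apply, conj_trivial]
  rw [apply_eq_sum_ent, Finset.sum_mul]
  refine Finset.sum_congr rfl fun j _ => ?_
  ring

/-- `⟪ω, Dω⟫ = Σᵢⱼ Sᵢⱼ ωᵢ ωⱼ` (the antisymmetric part drops out). [folklore] -/
private theorem inner_apply_eq_sum_symEnt (D : E3 →L[ℝ] E3) (w : E3) :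
    ⟪w, D w⟫ = ∑ i, ∑ j, symEnt D i j * (w i * w j) := by
  rw [inner_apply_eq_sum_ent]
  have hswap : ∑ i, ∑ j, ent D i j * (w i * w j) = ∑ i, ∑ j, ent D j i * (w i * w j) := by
    rw [Finset.sum_comm]
    exact Finset.sum_congr rfl fun i _ => Finset.sum_congr rfl fun j _ => by ring
  have : ∑ i, ∑ j, symEnt D i j * (w i * w j) =
      (∑ i, ∑ j, ent D i j * (w i * w j) + ∑ i, ∑ j, ent D j i * (w i * w j)) / 2 := by
    rw [← Finset.sum_add_distrib, Finset.sum_div]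
    refine Finset.sum_congr rfl fun i _ => ?_
    rw [← Finset.sum_add_distrib, Finset.sum_div]
    refine Finset.sum_congr rfl fun j _ => ?_
    unfold symEnt; ring
  rw [this, ← hswap]; ring

/-- `Σᵢ Sᵢᵢ = tr D`. [folklore] -/
private theorem sum_symEnt_diag_eq_trace (D : E3 →L[ℝ] E3) :
    ∑ i, symEnt D i i = LinearMap.trace ℝ E3 (D : E3 →ₗ[ℝ] E3) := by
  rw [LinearMap.trace_eq_matrix_trace ℝ (EuclideanSpace.basisFun (Fin 3) ℝ).toBasis, Matrix.trace]
  refine Finset.sum_congr rfl fun i _ => ?_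
  rw [Matrix.diag_apply, LinearMap.toMatrix_apply]
  simp [symEnt, ent]

/-- **Pointwise sector bound with the sharp classical constant**: for a trace-free operator `D` on
`ℝ³` and every `ω`, `|⟪ω, Dω⟫| ≤ √(2/3) · (Σᵢⱼ Sᵢⱼ²)^{1/2} · ‖w‖²`, `S = ½(D + Dᵀ)` — Cauchy–Schwarz
in the Frobenius product against the trace-free tensor `ω ⊗ ω − ⅓|ω|² I`, whose Frobenius norm is
`√(2/3)|ω|²`. [folklore] -/
private theorem abs_inner_apply_le_of_trace_eq_zero (D : E3 →L[ℝ] E3)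
    (htr : LinearMap.trace ℝ E3 (D : E3 →ₗ[ℝ] E3) = 0) (w : E3) :
    |⟪w, D w⟫| ≤ Real.sqrt (2 / 3) * Real.sqrt (symNormSq D) * ‖w‖ ^ 2 := by
  set c : ℝ := ‖w‖ ^ 2 / 3 with hc
  have hn : ‖w‖ ^ 2 = ∑ i, w i ^ 2 := by
    rw [EuclideanSpace.norm_sq_eq]
    exact Finset.sum_congr rfl fun i _ => by rw [Real.norm_eq_abs, sq_abs]
  -- the trace-free shift
  let Q : Fin 3 → Fin 3 → ℝ := fun i j => w i * w j - if i = j then c else 0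
  have hdiag : ∑ i, symEnt D i i = 0 := by rw [sum_symEnt_diag_eq_trace, htr]
  have key : ⟪w, D w⟫ = ∑ i, ∑ j, symEnt D i j * Q i j := by
    rw [inner_apply_eq_sum_symEnt]
    have : ∑ i, ∑ j, symEnt D i j * Q i j =
        ∑ i, ∑ j, symEnt D i j * (w i * w j) - c * ∑ i, symEnt D i i := by
      simp only [Q, mul_sub, Finset.sum_sub_distrib, mul_ite, mul_zero]
      congr 1
      rw [Finset.mul_sum]
      refine Finset.sum_congr rfl fun i _ => ?_
      rw [Finset.sum_ite_eq]; simp [mul_comm]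
    rw [this, hdiag, mul_zero, sub_zero]
  -- Cauchy–Schwarz over `Fin 3 × Fin 3`
  have hCS : (∑ i, ∑ j, symEnt D i j * Q i j) ^ 2 ≤ symNormSq D * ∑ i, ∑ j, Q i j ^ 2 := by
    have h := Finset.sum_mul_sq_le_sq_mul_sq (Finset.univ : Finset (Fin 3 × Fin 3))
      (fun p => symEnt D p.1 p.2) (fun p => Q p.1 p.2)
    simpa only [symNormSq, ← Finset.sum_product', Finset.univ_product_univ] using h
  have hQ : ∑ i, ∑ j, Q i j ^ 2 = 2 / 3 * (‖w‖ ^ 2) ^ 2 := by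
    have h1 : ∀ i j, Q i j ^ 2 =
        (w i * w j) ^ 2 - 2 * c * (if i = j then w j ^ 2 else 0) + (if i = j then c ^ 2 else 0) := by
      intro i j
      simp only [Q]
      split_ifs with h
      · subst h; ring
      · ring
    have h2 : ∑ i, ∑ j, (w i * w j) ^ 2 = (∑ i, w i ^ 2) ^ 2 := by
      rw [sq (∑ i, w i ^ 2), Finset.sum_mul_sum]
      exact Finset.sum_congr rfl fun i _ => Finset.sum_congr rfl fun j _ => by ring
    simp only [h1, Finset.sum_add_distrib, Finset.sum_sub_distrib, Finset.sum_ite_eq, Finset.mem_univ,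
      if_true, ← Finset.mul_sum, h2, Finset.sum_const, Finset.card_univ, Fintype.card_fin,
      nsmul_eq_mul, Nat.cast_ofNat]
    rw [← hn, hc]
    ring
  have hsq : ⟪w, D w⟫ ^ 2 ≤ (Real.sqrt (2 / 3) * Real.sqrt (symNormSq D) * ‖w‖ ^ 2) ^ 2 := by
    rw [key]
    calc (∑ i, ∑ j, symEnt D i j * Q i j) ^ 2 ≤ symNormSq D * ∑ i, ∑ j, Q i j ^ 2 := hCS
      _ = (Real.sqrt (2 / 3) * Real.sqrt (symNormSq D) * ‖w‖ ^ 2) ^ 2 := by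
        rw [hQ, mul_pow, mul_pow, Real.sq_sqrt (by norm_num), Real.sq_sqrt (symNormSq_nonneg D)]
        ring
  have hnn : 0 ≤ Real.sqrt (2 / 3) * Real.sqrt (symNormSq D) * ‖w‖ ^ 2 := by positivity
  calc |⟪w, D w⟫| ≤ Real.sqrt ((Real.sqrt (2 / 3) * Real.sqrt (symNormSq D) * ‖w‖ ^ 2) ^ 2) :=
        Real.abs_le_sqrt hsq
    _ = Real.sqrt (2 / 3) * Real.sqrt (symNormSq D) * ‖w‖ ^ 2 := Real.sqrt_sq hnn

/-- **The printed constant exceeds the sharp classical one**: `1/√3 ≤ Kc = (π²−3)^{3/2}/π³`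
(`0.5774 ≤ 0.5807`; equivalently `π⁶ ≤ 3(π²−3)³`, which follows from `π > 3.14`): the printed
`K = tanh³δ_h` of Prop 8 (38) dominates the classical sector constant. [cite: Wayman2026, Prop 8 (38) p.13 l.58–72; Prop 9 (44) p.16 l.9–26] -/
theorem inv_sqrt_three_le_Kc : 1 / Real.sqrt 3 ≤ Kc := by
  unfold Kc
  have hπ : 3.14 < Real.pi := Real.pi_gt_d2
  have hπ0 : 0 < Real.pi := Real.pi_pos
  have hq : 0 < Real.pi ^ 2 - 3 := by nlinarith
  set q : ℝ := Real.pi ^ 2 - 3 with hqdef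
  have h32 : q ^ (3 / 2 : ℝ) = q * Real.sqrt q := by
    rw [show (3 / 2 : ℝ) = 1 + 1 / 2 by norm_num, Real.rpow_add hq, Real.rpow_one, Real.sqrt_eq_rpow]
  rw [h32]
  have hs3 : 0 < Real.sqrt 3 := Real.sqrt_pos.2 (by norm_num)
  rw [div_le_div_iff₀ hs3 (by positivity), one_mul]
  -- goal: π³ ≤ q * √q * √3 ; square both sides
  have hrhs : q * Real.sqrt q * Real.sqrt 3 = Real.sqrt (3 * q ^ 3) := by
    rw [show 3 * q ^ 3 = q ^ 2 * (q * 3) by ring, Real.sqrt_mul (by positivity), Real.sqrt_sq hq.le,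
      Real.sqrt_mul hq.le]
    ring
  rw [hrhs]
  -- π⁶ ≤ 3 (π² − 3)³ from π > 3.14
  have hp2 : 9.8596 < Real.pi ^ 2 := by nlinarith
  have h6 : (Real.pi ^ 3) ^ 2 ≤ 3 * q ^ 3 := by
    rw [hqdef]
    nlinarith [sq_nonneg (Real.pi ^ 2 - 9.8596), hp2, mul_pos (sub_pos.2 hp2) (sub_pos.2 hp2)]
  calc Real.pi ^ 3 = Real.sqrt ((Real.pi ^ 3) ^ 2) := (Real.sqrt_sq (by positivity)).symm
    _ ≤ Real.sqrt (3 * q ^ 3) := Real.sqrt_le_sqrt h6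


/-! ### §E Assembly: Prop 9 (44) holds, with the sharp classical constant `1/√3 ≤ tanh³δ_h` -/

/-- `per > 0`. [folklore] -/
private theorem per_pos' : 0 < per := by unfold per aStar; positivity

/-- **Prop 9 (44) p.16 is TRUE for every smooth divergence-free `per`-periodic field — kernel
discharge of `Step_P9`.** Pointwise `|ω·(∇u)ω| = |ω·Sω| ≤ √(2/3)|S|_F|ω|²` (`S` trace-free by
incompressibility), Cauchy–Schwarz on the period cell, and Miller's identity `∫_{𝕋³}|S|² = ½∫_{𝕋³}|ω|²`
give `|∫ ω·Sω| ≤ (1/√3)‖ω‖_{L∞} Ω`, and `1/√3 ≈ 0.5774 ≤ tanh³δ_h = (π²−3)^{3/2}/π³ ≈ 0.5807`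
(`inv_sqrt_three_le_Kc`). The printed triad-sum derivation (p.16 l.27–69, Prop 8) is not used.
[cite: Wayman2026, Prop 9 (44) p.16 l.9–26] [cite: Miller2019, Prop. 3.1] -/
theorem step_P9_holds : Step_P9 := by
  intro v hv hdiv hper
  have hL : 0 < per := per_pos'
  have h1le : (1 : WithTop ℕ∞) ≤ ((⊤ : ℕ∞) : WithTop ℕ∞) := by exact_mod_cast le_top
  have hv1 : ContDiff ℝ 1 v := hv.of_le h1le
  have hcurlc : Continuous (curl v) := continuous_curl hv1
  have hDc : Continuous (fderiv ℝ v) := hv.continuous_fderiv (by simp)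
  -- the sup of `|ω|` is attained-bounded (periodic continuous field)
  have hbdd : BddAbove (Set.range fun x => ‖curl v x‖) :=
    bddAbove_range_norm_of_periodic hL hcurlc (curl_periodic hper)
  set M : ℝ := supN (curl v) with hM
  have hMx : ∀ x, ‖curl v x‖ ≤ M := fun x => by rw [hM]; exact le_ciSup hbdd x
  have hM0 : 0 ≤ M := (norm_nonneg _).trans (hMx 0)
  -- incompressibility = trace-free velocity gradient
  have htr : ∀ x, LinearMap.trace ℝ E3 (fderiv ℝ v x : E3 →ₗ[ℝ] E3) = 0 := hdiv
  -- the two weights of the Cauchy–Schwarz step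
  set f : E3 → ℝ := fun x => Real.sqrt (symNormSq (fderiv ℝ v x)) with hf
  set g : E3 → ℝ := fun x => ‖curl v x‖ with hg
  have hpt : ∀ x, |⟪curl v x, fderiv ℝ v x (curl v x)⟫| ≤ Real.sqrt (2 / 3) * M * (f x * g x) := by
    intro x
    calc |⟪curl v x, fderiv ℝ v x (curl v x)⟫|
        ≤ Real.sqrt (2 / 3) * Real.sqrt (symNormSq (fderiv ℝ v x)) * ‖curl v x‖ ^ 2 :=
          abs_inner_apply_le_of_trace_eq_zero _ (htr x) _
      _ ≤ Real.sqrt (2 / 3) * Real.sqrt (symNormSq (fderiv ℝ v x)) * (M * ‖curl v x‖) := by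
          apply mul_le_mul_of_nonneg_left _ (by positivity)
          rw [sq]
          exact mul_le_mul_of_nonneg_right (hMx x) (norm_nonneg _)
      _ = Real.sqrt (2 / 3) * M * (f x * g x) := by rw [hf, hg]; ring
  -- continuity of the integrands
  have hent : ∀ i j, Continuous fun x => ent (fderiv ℝ v x) i j := fun i j =>
    (EuclideanSpace.proj i).continuous.comp (hDc.clm_apply continuous_const)
  have hSc : Continuous fun x => symNormSq (fderiv ℝ v x) := by
    unfold symNormSq symEnt
    exact continuous_finsetSum _ fun i _ => continuous_finsetSum _ fun j _ =>
      (((hent i j).add (hent j i)).div_const 2).pow 2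
  have hfc : Continuous f := hSc.sqrt
  have hgc : Continuous g := hcurlc.norm
  have hIc : Continuous fun x => ⟪curl v x, fderiv ℝ v x (curl v x)⟫ :=
    hcurlc.inner (hDc.clm_apply hcurlc)
  -- the integral inequality on the cell
  haveI := isFiniteMeasure_restrict_cell hL.le
  have key : |stretch per v| ≤ Real.sqrt (2 / 3) * M * ∫ x in cell per, f x * g x := by
    unfold stretch
    calc |∫ x in cell per, ⟪curl v x, fderiv ℝ v x (curl v x)⟫|
        ≤ ∫ x in cell per, |⟪curl v x, fderiv ℝ v x (curl v x)⟫| := abs_integral_le_integral_abs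
      _ ≤ ∫ x in cell per, Real.sqrt (2 / 3) * M * (f x * g x) :=
          integral_mono (integrableOn_cell hL.le hIc).abs
            ((integrableOn_cell hL.le (hfc.mul hgc)).const_mul _) hpt
      _ = Real.sqrt (2 / 3) * M * ∫ x in cell per, f x * g x := integral_const_mul _ _
  -- Cauchy–Schwarz (Hölder with p = q = 2)
  have hf2 : MemLp f (ENNReal.ofReal 2) (volume.restrict (cell per)) := by
    rw [ENNReal.ofReal_ofNat]
    exact (memLp_two_iff_integrable_sq hfc.aestronglyMeasurable).2 (integrableOn_cell hL.le (hfc.pow 2))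
  have hg2 : MemLp g (ENNReal.ofReal 2) (volume.restrict (cell per)) := by
    rw [ENNReal.ofReal_ofNat]
    exact (memLp_two_iff_integrable_sq hgc.aestronglyMeasurable).2 (integrableOn_cell hL.le (hgc.pow 2))
  have hH : ∫ x in cell per, f x * g x ≤
      Real.sqrt (∫ x in cell per, f x ^ 2) * Real.sqrt (∫ x in cell per, g x ^ 2) := by
    have h := integral_mul_le_Lp_mul_Lq_of_nonneg (μ := volume.restrict (cell per))
      Real.HolderConjugate.two_two (ae_of_all _ fun x => Real.sqrt_nonneg _)
      (ae_of_all _ fun x => norm_nonneg _) hf2 hg2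
    rw [Real.sqrt_eq_rpow, Real.sqrt_eq_rpow]
    simpa only [Real.rpow_two] using h
  -- the two L² norms: `∫ f² = ∫ |S|² = ½ Ω` (Miller), `∫ g² = Ω`
  have hf2i : ∫ x in cell per, f x ^ 2 = 2⁻¹ * Ens per v := by
    have h : (fun x => f x ^ 2) = fun x => symNormSq (fderiv ℝ v x) :=
      funext fun x => Real.sq_sqrt (symNormSq_nonneg _)
    rw [h, integral_symNormSq_eq_half_integral_curl_sq hL hv hdiv hper]
    rfl
  have hg2i : ∫ x in cell per, g x ^ 2 = Ens per v := rfl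
  have hE0 : 0 ≤ Ens per v := integral_nonneg fun x => sq_nonneg _
  rw [hf2i, hg2i] at hH
  have hsq : Real.sqrt (2⁻¹ * Ens per v) * Real.sqrt (Ens per v) = Real.sqrt 2⁻¹ * Ens per v := by
    rw [Real.sqrt_mul (by norm_num), mul_assoc, Real.mul_self_sqrt hE0]
  have hconst : Real.sqrt (2 / 3) * Real.sqrt 2⁻¹ = 1 / Real.sqrt 3 := by
    rw [← Real.sqrt_mul (by norm_num), show (2 / 3 : ℝ) * 2⁻¹ = 1 / 3 by norm_num,
      Real.sqrt_div zero_le_one, Real.sqrt_one]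
  calc |stretch per v| ≤ Real.sqrt (2 / 3) * M * ∫ x in cell per, f x * g x := key
    _ ≤ Real.sqrt (2 / 3) * M * (Real.sqrt (2⁻¹ * Ens per v) * Real.sqrt (Ens per v)) :=
        mul_le_mul_of_nonneg_left hH (by positivity)
    _ = 1 / Real.sqrt 3 * M * Ens per v := by rw [hsq, ← hconst]; ring
    _ ≤ Kc * M * Ens per v :=
        mul_le_mul_of_nonneg_right (mul_le_mul_of_nonneg_right inv_sqrt_three_le_Kc hM0) hE0

/-- **Thm 7 (48) holds given Prop 4 (26)**: with `Step_P9` discharged, the enstrophy estimate follows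
from the enstrophy identity alone (`thm7_of_steps`). [cite: Wayman2026, Thm 7 (48) p.17 l.47–55] -/
theorem stepT7_of_stepP4 (h4 : Step_P4) : Step_T7 := thm7_of_steps h4 step_P9_holds



/-! ### §F Lemma 2 (22): energy decay `E(t) ≤ E(0)` — kernel discharge of `Step_L2`, hence Thm 13 (3) -/

/-- **Energy of a rescaled slice.** For an `L`-periodic field `w` (`L > 0`), the torus kinetic energy of
the descended Leray rescaling `y ↦ L·w(Ly)` is `L⁻¹ · E_L(w)`, `E_L(w) = ½∫_{[0,L)³}|w|²`. [folklore] -/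
private theorem kineticEnergy_descend_rescale {L : ℝ} (hL : 0 < L) {w : E3 → E3} (hper : IsPer L w) :
    Torus.kineticEnergy (fun x => (L • w (L • Torus.repr x) : E3)) = L⁻¹ * En L w := by
  have hperw : IsLatticePeriodic (fun y => L • w (L • y)) :=
    ClayVariants.isLatticePeriodic_smul_comp_smul (F := E3) hper L
  have hlift : Torus.lift (fun x => (L • w (L • Torus.repr x) : E3)) = fun y => L • w (L • y) :=
    Torus.lift_descend_holds (fun y => L • w (L • y)) hperw
  unfold Torus.kineticEnergy En
  rw [Torus.integral_eq_integral_lift_holds]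
  have h1 : (Torus.lift fun x => ‖(L • w (L • Torus.repr x) : E3)‖ ^ 2) =
      fun y => L ^ 2 * ‖w (L • y)‖ ^ 2 := by
    have : (Torus.lift fun x => ‖(L • w (L • Torus.repr x) : E3)‖ ^ 2) =
        fun y => ‖Torus.lift (fun x => (L • w (L • Torus.repr x) : E3)) y‖ ^ 2 := rfl
    rw [this, hlift]
    funext y
    rw [norm_smul, mul_pow, Real.norm_eq_abs, sq_abs]
  rw [h1, integral_const_mul, ← cell_one_eq_unitCube,
    Measure.setIntegral_comp_smul_of_pos volume (fun x => ‖w x‖ ^ 2) (cell 1) hL,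
    ← cell_eq_smul_cell_one hL, smul_eq_mul, finrank_euclideanSpace, Fintype.card_fin]
  field_simp

/-- **Lemma 2 (22) p.7 holds — kernel discharge of `Step_L2`**: along every `per`-periodic classical
solution on `[0,T)`, `E(t) ≤ E(0)`. Leray-rescale to period `1` (`IsClassicalNSSolutionOn.nsRescale_holds`),
descend to `𝕋³` (`ClayVariants.torus_descend_of_periodic`), apply the torus energy balance
`dK/ds = −ν‖∇ũ‖² ≤ 0` (`Torus.IsClassicalNSSolutionOn.energy_balance_holds`), and scale back
(`kineticEnergy_descend_rescale`). [cite: Wayman2026, Lemma 2 (22) p.7 l.102–109] [cite: DoeringFoias2002, §2 eq. (2.4)] -/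
theorem step_L2_holds : Step_L2 := by
  intro ν T u₀ u p hν hS t ht
  have hc : 0 < per := per_pos'
  set c : ℝ := per with hcdef
  have hT0 : 0 < T := ht.1.trans_lt ht.2
  -- Leray rescaling to period 1
  have hresc := IsClassicalNSSolutionOn.nsRescale_holds hS.classical hc
  rw [nsRescaleForce_zero] at hresc
  have hset : (fun s : ℝ => c ^ 2 * s) ⁻¹' Ico 0 T = Ico 0 (T / c ^ 2) := by
    have hc2 : 0 < c ^ 2 := by positivity
    ext s
    simp only [mem_preimage, mem_Ico]
    rw [lt_div_iff₀ hc2, mul_comm s]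
    constructor
    · rintro ⟨h1, h2⟩; exact ⟨nonneg_of_mul_nonneg_right (by linarith) hc2 |> fun h => by nlinarith, h2⟩
    · rintro ⟨h1, h2⟩; exact ⟨by positivity, h2⟩
  rw [hset] at hresc
  have hmem : ∀ s ∈ Ico 0 (T / c ^ 2), c ^ 2 * s ∈ Ico 0 T := by
    intro s hs
    have : s ∈ (fun s : ℝ => c ^ 2 * s) ⁻¹' Ico 0 T := by rw [hset]; exact hs
    exact this
  have hperU : ∀ s ∈ Ico 0 (T / c ^ 2),
      IsLatticePeriodic (nsRescale c u s) ∧ IsLatticePeriodic (nsRescalePressure c p s) := by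
    intro s hs
    refine ⟨?_, ?_⟩
    · exact ClayVariants.isLatticePeriodic_smul_comp_smul (F := E3) (hS.perU _ (hmem s hs)) c
    · have h := ClayVariants.isLatticePeriodic_smul_comp_smul (F := ℝ) (hS.perP _ (hmem s hs)) (c ^ 2)
      simp only [smul_eq_mul] at h
      exact h
  obtain ⟨hTor, hlift⟩ := ClayVariants.torus_descend_of_periodic hresc hperU
  -- the torus energy is antitone on `[0, T/c²)`
  set K : ℝ → ℝ := fun s => Torus.kineticEnergy (fun x => nsRescale c u s (Torus.repr x)) with hK
  have hconv : Convex ℝ (Ico 0 (T / c ^ 2)) := convex_Ico _ _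
  have hder : ∀ s ∈ Ico 0 (T / c ^ 2), HasDerivWithinAt K
      (-ν * Torus.gradNormSq (fun x => nsRescale c u s (Torus.repr x))) (Ico 0 (T / c ^ 2)) s := by
    intro s hs
    have h := Torus.IsClassicalNSSolutionOn.energy_balance_holds hTor hconv hs
    simpa only [Pi.zero_apply, inner_zero_left, integral_zero, add_zero] using h
  have hanti : AntitoneOn K (Ico 0 (T / c ^ 2)) := by
    refine antitoneOn_of_hasDerivWithinAt_nonpos hconv (fun s hs => (hder s hs).continuousWithinAt)
      (fun s hs => ((hder s (interior_subset hs)).mono interior_subset)) fun s _ => ?_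
    have := Torus.gradNormSq_nonneg (fun x => nsRescale c u s (Torus.repr x))
    nlinarith
  -- compare s = t/c² with s = 0
  have hs0 : (0 : ℝ) ∈ Ico 0 (T / c ^ 2) := ⟨le_rfl, by positivity⟩
  have hst : t / c ^ 2 ∈ Ico 0 (T / c ^ 2) :=
    ⟨div_nonneg ht.1 (by positivity), div_lt_div_of_pos_right ht.2 (by positivity)⟩
  have hmono := hanti hs0 hst hst.1
  -- translate both energies back to the period cell
  have hKs : ∀ s ∈ Ico 0 (T / c ^ 2), K s = c⁻¹ * En c (u (c ^ 2 * s)) := by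
    intro s hs
    have h := kineticEnergy_descend_rescale hc (hS.perU _ (hmem s hs))
    simpa only [hK, nsRescale_apply] using h
  rw [hKs _ hs0, hKs _ hst, mul_zero, hS.initial] at hmono
  have hct : c ^ 2 * (t / c ^ 2) = t := by field_simp
  rw [hct] at hmono
  exact le_of_mul_le_mul_left hmono (inv_pos.2 hc)


/-- **Thm 13 (3) p.31 l.15–17 holds** («Part (3) is Lemma 2», p.31 l.20): with `Step_L2` discharged,
the energy-bound part of the claimed theorem is a kernel theorem. [cite: Wayman2026, Thm 13 (3) p.31 l.15–17; Lemma 2 (22) p.7 l.102–109] -/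
theorem thm13_3_holds : Thm13_3 per := thm13_3_of_lemma2 step_L2_holds


/-! ### §G Thm 11 Step 1 (Fujita–Kato + BKM) and the uniqueness word — kernel discharges of `Step11_1` and
`Step11_unique` (rev 4, ns-claims-lit-3 g8): with these, Part (1) of Thm 13 reduces to the a priori
sup-vorticity bound `VortBound` alone (`thm13_1_of_vortBound`). -/

/-- **The torus vorticity magnitude of a descended periodic field is `|curl|²` at the representative.**
[folklore] -/
private theorem torusVorticitySqAt_descend {w : E3 → E3} (hw : ContDiff ℝ ∞ w) (hper : IsLatticePeriodic w)
    (x : UnitAddTorus (Fin 3)) :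
    torusVorticitySqAt (fun z => w (Torus.repr z)) x = ‖curl w (Torus.repr x)‖ ^ 2 := by
  set U : UnitAddTorus (Fin 3) → E3 := fun z => w (Torus.repr z) with hUdef
  have hlift : Torus.lift U = w := Torus.lift_descend_holds w hper
  have hU : Torus.IsSmooth U := by
    show ContDiff ℝ ∞ (Torus.lift U); rw [hlift]; exact hw
  have hU1 : Torus.IsContDiff 1 U := hU.isContDiff (by exact_mod_cast le_top)
  have hD : ∀ (y : E3) (i j : Fin 3),
      Torus.partialDeriv j U (Torus.proj y) i = ent (fderiv ℝ w y) i j := by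
    intro y i j
    rw [Torus.partialDeriv_eq_fderiv_apply hU1, ← Torus.fderiv_lift, hlift, ent]
  have hx : Torus.proj (Torus.repr x) = x := Torus.proj_repr x
  conv_lhs => rw [← hx]
  simp only [torusVorticitySqAt, hD, norm_curl_sq_eq_half_sum]


/-- **Thm 11 Step 1 (Fujita–Kato + BKM (71)) p.27 l.4–12 holds — kernel discharge of `Step11_1`**:
an a priori bound on `‖ω(t)‖_{L∞}` along every class solution on every slab yields a global Clay-sense
solution on `T³(a*)` for every datum. Proof: Leray-rescale the datum to period 1; in the periodic blow-up
alternative (`ClayVariants.clayPeriodic_solvable_or_gradientSupBlowup`) the blow-up branch carries a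
classical solution with UNBOUNDED enstrophy on `[0,T*)`; rescaled back to period `per` it is a class solution,
so `VortBound` bounds its vorticity pointwise, whence (torus enstrophy Grönwall under a vorticity majorant,
`Torus.gradNormSq_le_mul_exp_integral_vorticityBound`) its enstrophy is bounded — contradiction; the solvable
branch is transported to period `per` with velocity AND pressure periodic by
`ClayVariants.clayPeriodic_solvable_zero_iff_errata` + `clayPeriodicErrata_solvable_nsRescaleData_iff`.
[cite: Wayman2026, Thm 11 Step 1 (71) p.27 l.4–12] [cite: BealeKatoMajda1984, Thm 1] [cite: RobinsonRodrigoSadowskiCUP2016, Thm 12.3] -/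
theorem step11_1_holds : Step11_1 := by
  intro hV ν hν u₀ hu₀
  obtain ⟨hs, hd, hper⟩ := hu₀
  have hc : 0 < per := per_pos'
  have hc' : 0 < per⁻¹ := inv_pos.2 hc
  -- the period-1 datum
  set w₀ : E3 → E3 := nsRescaleData per u₀ with hw₀
  have hw₀s : ContDiff ℝ ∞ w₀ := by
    show ContDiff ℝ ∞ (fun x => per • u₀ (per • x))
    exact (hs.comp (contDiff_id.const_smul per)).const_smul per
  have hw₀d : NSWave0.IsDivFree w₀ := by
    show VectorCalculus.IsDivFree (fun x => per • (fun y => u₀ (per • y)) x)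
    exact VectorCalculus.IsDivFree.const_smul
      ((hs.differentiable (by simp)).comp (differentiable_id.const_smul per))
      (VectorCalculus.IsDivFree.comp_smul hd per) per
  have hw₀p : IsLatticePeriodic w₀ := ClayVariants.isLatticePeriodic_nsRescaleData hper
  -- Clay (B)-solvability of the rescaled datum, by the blow-up alternative
  have hsolv : clayPeriodic.Solvable ν 0 w₀ := by
    rcases ClayVariants.clayPeriodic_solvable_or_gradientSupBlowup hν hw₀s hw₀d hw₀p with
      h | ⟨Ts, hTs, w, q, hcl, hw0, hperwq, -, hnb, -⟩
    · exact h
    exfalso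
    -- rescale the blow-up solution back to period `per`
    have hcl' := IsClassicalNSSolutionOn.nsRescale_holds hcl hc'
    rw [nsRescaleForce_zero] at hcl'
    have hset : (fun t : ℝ => per⁻¹ ^ 2 * t) ⁻¹' Ico 0 Ts = Ico 0 (per ^ 2 * Ts) := by
      have hp2 : 0 < per ^ 2 := by positivity
      ext t
      simp only [mem_preimage, mem_Ico, inv_pow]
      rw [inv_mul_lt_iff₀ hp2]
      constructor
      · rintro ⟨h1, h2⟩
        exact ⟨by nlinarith [mul_nonneg hp2.le h1, inv_mul_cancel₀ hp2.ne'], h2⟩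
      · rintro ⟨h1, h2⟩
        exact ⟨by positivity, h2⟩
    rw [hset] at hcl'
    have hmem : ∀ t ∈ Ico 0 (per ^ 2 * Ts), per⁻¹ ^ 2 * t ∈ Ico 0 Ts := by
      intro t ht
      have : t ∈ (fun t : ℝ => per⁻¹ ^ 2 * t) ⁻¹' Ico 0 Ts := by rw [hset]; exact ht
      exact this
    set u' : ℝ → E3 → E3 := nsRescale per⁻¹ w with hu'
    set p' : ℝ → E3 → ℝ := nsRescalePressure per⁻¹ q with hp'
    have hu'0 : u' 0 = u₀ := by
      rw [hu', nsRescale_zero_time, hw0, hw₀, ← nsRescaleData_mul, mul_inv_cancel₀ hc.ne',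
        nsRescaleData_one]
    have hperU : ∀ t ∈ Ico 0 (per ^ 2 * Ts), IsPer per (u' t) := by
      intro t ht j x
      exact ClayVariants.periodic_smul_comp_inv_smul (hperwq _ (hmem t ht)).1 hc.ne' per⁻¹ j x
    have hperP : ∀ t ∈ Ico 0 (per ^ 2 * Ts), IsPer per (p' t) := by
      intro t ht j x
      have h := ClayVariants.periodic_smul_comp_inv_smul (F := ℝ) (hperwq _ (hmem t ht)).2 hc.ne'
        (per⁻¹ ^ 2) j x
      simp only [smul_eq_mul] at h
      show per⁻¹ ^ 2 * q (per⁻¹ ^ 2 * t) (per⁻¹ • (x + per • EuclideanSpace.single j 1)) =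
        per⁻¹ ^ 2 * q (per⁻¹ ^ 2 * t) (per⁻¹ • x)
      exact h
    have hSol : IsSol per ν (per ^ 2 * Ts) u₀ u' p' := ⟨⟨hs, hd, hper⟩, hcl', hu'0, hperU, hperP⟩
    obtain ⟨B, hB⟩ := hV ν hν u₀ ⟨hs, hd, hper⟩ (per ^ 2 * Ts) u' p' hSol
    -- pointwise vorticity bound along the period-1 solution
    have hwpt : ∀ s ∈ Ico 0 Ts, ∀ y, ‖curl (w s) y‖ ≤ per ^ 2 * max B 0 := by
      intro s hs' y
      have ht : per ^ 2 * s ∈ Ico 0 (per ^ 2 * Ts) :=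
        ⟨by have := hs'.1; positivity, mul_lt_mul_of_pos_left hs'.2 (by positivity)⟩
      have hsm : ContDiff ℝ ∞ (u' (per ^ 2 * s)) := hcl'.contDiff_velocity ht
      have h1 : ContDiff ℝ 1 (u' (per ^ 2 * s)) := hsm.of_le (by exact_mod_cast le_top)
      have hbdd := bddAbove_range_norm_of_periodic hc (continuous_curl h1) (curl_periodic (hperU _ ht))
      have hpt : ∀ x, ‖curl (u' (per ^ 2 * s)) x‖ ≤ max B 0 := fun x =>
        (le_ciSup hbdd x).trans ((hB _ ht).trans (le_max_left _ _))
      have hws : w s = fun z => per • u' (per ^ 2 * s) (per • z) := by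
        funext z
        simp only [hu', nsRescale_apply, smul_smul, mul_inv_cancel₀ hc.ne', inv_mul_cancel₀ hc.ne',
          one_smul, inv_pow]
        congr 1
        field_simp
      have hdiff : DifferentiableAt ℝ (fun z => u' (per ^ 2 * s) (per • z)) y :=
        ((hsm.differentiable (by simp)).comp (differentiable_id.const_smul per)) y
      rw [hws, curl_const_smul hdiff, curl_comp_smul', norm_smul, norm_smul, Real.norm_eq_abs,
        abs_of_pos hc, ← mul_assoc, ← sq]
      exact mul_le_mul_of_nonneg_left (hpt _) (by positivity)
    -- descend to the torus and bound the enstrophy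
    obtain ⟨hTor, -⟩ := ClayVariants.torus_descend_of_periodic hcl hperwq
    have hω : ∀ s ∈ Ico 0 Ts, ∀ x,
        torusVorticitySqAt (fun z => w s (Torus.repr z)) x ≤ (per ^ 2 * max B 0) ^ 2 := by
      intro s hs' x
      rw [torusVorticitySqAt_descend (hcl.contDiff_velocity hs') (hperwq s hs').1 x]
      exact pow_le_pow_left₀ (norm_nonneg _) (hwpt s hs' _) 2
    apply hnb
    refine ⟨Torus.gradNormSq (fun z => w 0 (Torus.repr z)) *
      Real.exp (2 * ((per ^ 2 * max B 0) * Ts)), ?_⟩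
    rintro _ ⟨t, ht, rfl⟩
    have hgr := Torus.gradNormSq_le_mul_exp_integral_vorticityBound (Fintype.card_fin 3) hν.le hTor
      (M := fun _ => per ^ 2 * max B 0) continuousOn_const (fun _ _ => by positivity) hω ht
    refine hgr.trans ?_
    rw [intervalIntegral.integral_const, smul_eq_mul, sub_zero]
    have hM0 : 0 ≤ per ^ 2 * max B 0 := by positivity
    refine mul_le_mul_of_nonneg_left (Real.exp_le_exp.2 ?_) (Torus.gradNormSq_nonneg _)
    nlinarith [ht.1, ht.2, hM0, mul_le_mul_of_nonneg_left ht.2.le hM0]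
  -- transport the global solution to period `per`, velocity and pressure periodic
  have herr : clayPeriodicErrata.Solvable ν 0 (nsRescaleData per u₀) :=
    (ClayVariants.clayPeriodic_solvable_zero_iff_errata ν w₀).1 hsolv
  obtain ⟨u, p, hu, hp, hns, hperup⟩ :=
    (ClayVariants.clayPeriodicErrata_solvable_nsRescaleData_iff hc ν u₀).1 herr
  exact ⟨u, p, hu, hp, hns, fun t ht => (hperup t ht).1, fun t ht => (hperup t ht).2⟩

/-- **Thm 11 / Thm 13 (1), the word «unique» (p.26 l.47) holds — kernel discharge of `Step11_unique`**:
two global Clay-sense solutions on `T³(a*)` from one datum have the same velocity. Leray-rescale both to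
period 1 (`ClayVariants.isNavierStokesSolution_nsRescale_zero`), read them as classical solutions on
`[0,∞) × ℝ³` (`isNavierStokesSolution_and_smooth_iff`), descend to `𝕋³` (`torus_descend_of_periodic`),
apply the torus energy uniqueness `Torus.IsClassicalNSSolutionOn.velocity_unique_of_mem`, lift and unscale.
[cite: Wayman2026, Thm 11 p.26 l.43–47; Thm 9 Step 1 p.21 l.20–21] [cite: RobinsonRodrigoSadowskiCUP2016, Thm 6.10 (uniqueness of strong solutions)] -/
theorem step11_unique_holds : Step11_unique := by
  intro ν hν u₀ hu₀ u₁ p₁ u₂ p₂ h₁ h₂ t ht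
  have hc : 0 < per := per_pos'
  obtain ⟨hu1, hp1, hns1, hperU1, hperP1⟩ := h₁
  obtain ⟨hu2, hp2, hns2, hperU2, hperP2⟩ := h₂
  -- rescale to period 1 and read as classical solutions on `[0, ∞)`
  obtain ⟨hns1', hu1', hp1'⟩ := isNavierStokesSolution_nsRescale_zero hns1 hu1 hp1 hc
  obtain ⟨hns2', hu2', hp2'⟩ := isNavierStokesSolution_nsRescale_zero hns2 hu2 hp2 hc
  obtain ⟨hcl1, h01⟩ := isNavierStokesSolution_and_smooth_iff.mp ⟨hns1', hu1', hp1'⟩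
  obtain ⟨hcl2, h02⟩ := isNavierStokesSolution_and_smooth_iff.mp ⟨hns2', hu2', hp2'⟩
  -- periodic slices
  have hper1 : ∀ s ∈ Ici (0 : ℝ),
      IsLatticePeriodic (nsRescale per u₁ s) ∧ IsLatticePeriodic (nsRescalePressure per p₁ s) := by
    intro s hs
    have hs' : 0 ≤ per ^ 2 * s := by have := mem_Ici.1 hs; positivity
    refine ⟨isLatticePeriodic_smul_comp_smul (F := E3) (hperU1 _ hs') per, ?_⟩
    have h := isLatticePeriodic_smul_comp_smul (F := ℝ) (hperP1 _ hs') (per ^ 2)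
    simp only [smul_eq_mul] at h
    exact h
  have hper2 : ∀ s ∈ Ici (0 : ℝ),
      IsLatticePeriodic (nsRescale per u₂ s) ∧ IsLatticePeriodic (nsRescalePressure per p₂ s) := by
    intro s hs
    have hs' : 0 ≤ per ^ 2 * s := by have := mem_Ici.1 hs; positivity
    refine ⟨isLatticePeriodic_smul_comp_smul (F := E3) (hperU2 _ hs') per, ?_⟩
    have h := isLatticePeriodic_smul_comp_smul (F := ℝ) (hperP2 _ hs') (per ^ 2)
    simp only [smul_eq_mul] at h
    exact h
  obtain ⟨hT1, hlift1⟩ := torus_descend_of_periodic hcl1 hper1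
  obtain ⟨hT2, hlift2⟩ := torus_descend_of_periodic hcl2 hper2
  -- torus uniqueness from the common initial slice
  have h0 : (fun x => nsRescale per u₁ 0 (Torus.repr x)) = fun x => nsRescale per u₂ 0 (Torus.repr x) := by
    rw [h01, h02]
  have hs0 : (0 : ℝ) ∈ Ici (0 : ℝ) := mem_Ici.2 le_rfl
  have hst : t / per ^ 2 ∈ Ici (0 : ℝ) := mem_Ici.2 (div_nonneg ht (by positivity))
  have huniq := Torus.IsClassicalNSSolutionOn.velocity_unique_of_mem hν.le (convex_Ici 0) hT1 hT2
    hs0 h0 hst (div_nonneg ht (by positivity))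
  have hv : nsRescale per u₁ (t / per ^ 2) = nsRescale per u₂ (t / per ^ 2) := by
    rw [← hlift1 _ hst, ← hlift2 _ hst]
    exact congrArg Torus.lift huniq
  -- unscale
  funext x
  have hx := congrFun hv (per⁻¹ • x)
  simp only [nsRescale_apply, smul_smul, mul_inv_cancel₀ hc.ne', one_smul] at hx
  have htt : per ^ 2 * (t / per ^ 2) = t := by field_simp
  rw [htt] at hx
  exact smul_right_injective E3 hc.ne' hx

/-- **Thm 13 (1) from global existence alone**: with the uniqueness word discharged, Part (1) of the
claimed theorem reduces to `GlobalExistence`. [cite: Wayman2026, Thm 13 (1) p.30 l.55 – p.31 l.5] -/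
theorem thm13_1_of_globalExistence (hE : GlobalExistence) : Thm13_1 per :=
  thm13_1_of_steps hE step11_unique_holds

/-- **Thm 13 (1) from the a priori vorticity bound alone** (Thm 11 Step 1 + the uniqueness word, both
discharged): `VortBound → Thm13_1 per`. [cite: Wayman2026, Thm 11 p.26–27; Thm 13 (1) p.30–31] -/
theorem thm13_1_of_vortBound (hV : VortBound) : Thm13_1 per :=
  thm13_1_of_globalExistence (step11_1_holds hV)


/-! ### §H Prop 4 (26): the enstrophy identity `dΩ/dt = −2νP + 2∫ω·Sω` — kernel discharge of `Step_P4`,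
hence Thm 7 (`step_T7_holds`) (rev 5, ns-claims-lit-3 g8). Route: Leray rescaling `per ↦ 1`, descent to
`𝕋³`, the tree's torus `H¹` balance (Foias–Manley–Rosa–Temam (A.55)), and three transfer identities for
the descended Leray dilate (`‖∇U‖² = L·Ω`, `∫|ΔU|² = L³·P`, `∫⟪(U·∇)U,ΔU⟫ = L³·∫ω·Sω`). -/

/-! #### §H1 Helpers: lattice periodicity, cell transfer, Leray dilates -/

/-- The gradient of a `ℤ³`-periodic field is `ℤ³`-periodic. [folklore] -/
private theorem isLatticePeriodic_fderiv {v : E3 → E3} (hper : IsLatticePeriodic v) :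
    IsLatticePeriodic (fderiv ℝ v) := by
  intro j x
  have h : (fun y => v (y + EuclideanSpace.single j 1)) = v := funext fun y => hper j y
  show fderiv ℝ v (x + EuclideanSpace.single j 1) = fderiv ℝ v x
  rw [← fderiv_comp_add_right, h]

/-- The vorticity of a `ℤ³`-periodic field is `ℤ³`-periodic. [folklore] -/
private theorem isLatticePeriodic_curl {v : E3 → E3} (hper : IsLatticePeriodic v) :
    IsLatticePeriodic (curl v) := by
  intro j x
  show curl v (x + EuclideanSpace.single j 1) = curl v x
  rw [curl_eq_curlCLM, curl_eq_curlCLM, isLatticePeriodic_fderiv hper j x]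

/-- `∫_{𝕋³} g ∘ repr = ∫_{[0,1)³} g` for a `ℤ³`-periodic integrand. [folklore] -/
private theorem integral_descend_eq_setIntegral_cell {g : E3 → ℝ} (hper : IsLatticePeriodic g) :
    ∫ x, g (Torus.repr x) = ∫ y in cell 1, g y := by
  have h : Torus.lift (fun x => g (Torus.repr x)) = g := Torus.lift_descend_holds g hper
  rw [Torus.integral_eq_integral_lift_holds, h, cell_one_eq_unitCube]

/-- `∫_{[0,1)³} g(Ly) dy = L⁻³ ∫_{[0,L)³} g`. [folklore] -/
private theorem setIntegral_cell_one_comp_smul {L : ℝ} (hL : 0 < L) (g : E3 → ℝ) :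
    ∫ y in cell 1, g (L • y) = (L ^ 3)⁻¹ * ∫ x in cell L, g x := by
  rw [Measure.setIntegral_comp_smul_of_pos volume g (cell 1) hL, ← cell_eq_smul_cell_one hL,
    smul_eq_mul, finrank_euclideanSpace, Fintype.card_fin]

/-- The Leray dilate `y ↦ L·v(Ly)` of a smooth divergence-free `L`-periodic field is smooth,
divergence free and `ℤ³`-periodic. [folklore] -/
private theorem dilate_props {L : ℝ} {v : E3 → E3} (hv : ContDiff ℝ ∞ v)
    (hdiv : VectorCalculus.IsDivFree v) (hper : IsPer L v) :
    ContDiff ℝ ∞ (fun y => (L • v (L • y) : E3)) ∧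
      VectorCalculus.IsDivFree (fun y => (L • v (L • y) : E3)) ∧
        IsLatticePeriodic (fun y => (L • v (L • y) : E3)) :=
  ⟨(hv.comp (contDiff_id.const_smul L)).const_smul L,
    VectorCalculus.IsDivFree.const_smul
      ((hv.differentiable (by simp)).comp (differentiable_id.const_smul L))
      (VectorCalculus.IsDivFree.comp_smul hdiv L) L,
    ClayVariants.isLatticePeriodic_smul_comp_smul (F := E3) hper L⟩

/-- `curl (L·v(L·))(y) = L²·(curl v)(Ly)`. [folklore] -/
private theorem curl_dilate {L : ℝ} {v : E3 → E3} (hv : ContDiff ℝ ∞ v) (y : E3) :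
    curl (fun z => (L • v (L • z) : E3)) y = L ^ 2 • curl v (L • y) := by
  have hdiff : DifferentiableAt ℝ (fun z => v (L • z)) y :=
    ((hv.differentiable (by simp)).comp (differentiable_id.const_smul L)) y
  rw [curl_const_smul hdiff, curl_comp_smul', smul_smul, sq]

/-- `D(L·v(L·))(y) = L²·(Dv)(Ly)`. [folklore] -/
private theorem fderiv_dilate {L : ℝ} {v : E3 → E3} (hv : ContDiff ℝ ∞ v) (y : E3) :
    fderiv ℝ (fun z => (L • v (L • z) : E3)) y = L ^ 2 • fderiv ℝ v (L • y) := by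
  have hdiff : DifferentiableAt ℝ (fun z => v (L • z)) y :=
    ((hv.differentiable (by simp)).comp (differentiable_id.const_smul L)) y
  rw [fderiv_fun_const_smul hdiff, fderiv_comp_smul_eq, smul_smul, sq]

/-- Smoothness of the vorticity of a smooth field. [folklore] -/
private theorem contDiff_curl_top {v : E3 → E3} (hv : ContDiff ℝ ∞ v) : ContDiff ℝ ∞ (curl v) := by
  rw [curl_eq_curlCLM_comp]
  exact curlCLM.contDiff.comp (hv.fderiv_right (m := ∞) (by simp))

/-- `D(curl (L·v(L·)))(y) = L³·(D curl v)(Ly)`. [folklore] -/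
private theorem fderiv_curl_dilate {L : ℝ} {v : E3 → E3} (hv : ContDiff ℝ ∞ v) (y : E3) :
    fderiv ℝ (curl (fun z => (L • v (L • z) : E3))) y = L ^ 3 • fderiv ℝ (curl v) (L • y) := by
  have hc : curl (fun z => (L • v (L • z) : E3)) = fun z => L ^ 2 • curl v (L • z) :=
    funext fun z => curl_dilate hv z
  have hdiff : DifferentiableAt ℝ (fun z => curl v (L • z)) y :=
    (((contDiff_curl_top hv).differentiable (by simp)).comp (differentiable_id.const_smul L)) y
  rw [hc, fderiv_fun_const_smul hdiff, fderiv_comp_smul_eq (curl v), smul_smul,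
    show L ^ 2 * L = L ^ 3 by ring]

/-- `|aD|²_F = a²|D|²_F`. [folklore] -/
private theorem frobeniusNormSq_smul (a : ℝ) (D : E3 →L[ℝ] E3) :
    frobeniusNormSq (a • D) = a ^ 2 * frobeniusNormSq D := by
  simp only [frobeniusNormSq, FunLike.coe_smul, Pi.smul_apply, norm_smul, mul_pow,
    Real.norm_eq_abs, sq_abs, Finset.mul_sum]

/-- `|D|²_F = Σᵢ ‖D eᵢ‖²` in the standard basis. [folklore] -/
private theorem frobeniusNormSq_eq_sum_single (D : E3 →L[ℝ] E3) :
    frobeniusNormSq D = ∑ i, ‖D (EuclideanSpace.single i 1)‖ ^ 2 := by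
  rw [frobeniusNormSq_eq_sum (EuclideanSpace.basisFun (Fin 3) ℝ)]
  simp only [EuclideanSpace.basisFun_apply]

/-! #### §H2 The three torus integrals of a descended Leray dilate, in terms of `Ens`, `Pal`, `stretch` -/

/-- **`‖∇U‖²₂ = L·Ω_L(v)`** for the descended dilate `U = (L·v(L·)) ∘ repr` of a smooth divergence-free
`L`-periodic field (`∫_{𝕋³}|∇U|² = ∫_{𝕋³}|curl U|²`, Ayala–Protas (2.4), then Leray scaling).
[cite: AyalaProtas2017, eq. (2.4)] -/
theorem gradNormSq_descend_dilate {L : ℝ} (hL : 0 < L) {v : E3 → E3} (hv : ContDiff ℝ ∞ v)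
    (hdiv : VectorCalculus.IsDivFree v) (hper : IsPer L v) :
    Torus.gradNormSq (fun x => (L • v (L • Torus.repr x) : E3)) = L * Ens L v := by
  obtain ⟨hw, hdivw, hperw⟩ := dilate_props hv hdiv hper
  set w : E3 → E3 := fun y => L • v (L • y) with hwdef
  set U : UnitAddTorus (Fin 3) → E3 := fun x => w (Torus.repr x) with hUdef
  have hlift : Torus.lift U = w := Torus.lift_descend_holds w hperw
  have hU : Torus.IsSmooth U := by
    show ContDiff ℝ ∞ (Torus.lift U); rw [hlift]; exact hw
  have hU1 : Torus.IsContDiff 1 U := hU.isContDiff (by exact_mod_cast le_top)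
  have hdivU : Torus.IsDivFree U := by
    refine (Torus.isDivFree_iff_trace_fderiv_lift hU1).2 fun y => ?_
    rw [hlift]
    exact hdivw y
  rw [gradNormSq_eq_two_mul_torusEnstrophy,
    ← integral_torusVorticitySqAt_eq_two_mul_torusEnstrophy hU hdivU]
  have h1 : ∀ x, torusVorticitySqAt U x = (fun y => ‖curl w y‖ ^ 2) (Torus.repr x) :=
    fun x => torusVorticitySqAt_descend hw hperw x
  have hperg : IsLatticePeriodic (fun y => ‖curl w y‖ ^ 2) := by
    intro j y
    show ‖curl w (y + EuclideanSpace.single j 1)‖ ^ 2 = ‖curl w y‖ ^ 2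
    rw [isLatticePeriodic_curl hperw j y]
  rw [integral_congr_ae (ae_of_all _ h1), integral_descend_eq_setIntegral_cell hperg]
  have h2 : (fun y => ‖curl w y‖ ^ 2) = fun y => L ^ 4 * ‖curl v (L • y)‖ ^ 2 := by
    funext y
    rw [hwdef, curl_dilate hv, norm_smul, mul_pow, Real.norm_eq_abs, sq_abs]
    ring
  have h5 := setIntegral_cell_one_comp_smul hL (fun x => ‖curl v x‖ ^ 2)
  beta_reduce at h5
  rw [h2, integral_const_mul, h5]
  unfold Ens
  field_simp

/-- **`∫_{𝕋³}|ΔU|² = L³·P_L(v)`** for the descended dilate: `|ΔU|² = |curl curl U|²` pointwise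
(`curl curl = −Δ` for divergence-free fields, Majda–Bertozzi Prop. 2.16), and `∫|curl ω|² = ∫|∇ω|²_F`
for the divergence-free vorticity `ω` (Ayala–Protas (2.4) applied to `ω`), then Leray scaling.
[cite: MajdaBertozziCUP2002, Prop. 2.16 (proof)] [cite: AyalaProtas2017, eq. (2.4)] -/
theorem integral_laplacian_sq_descend_dilate {L : ℝ} (hL : 0 < L) {v : E3 → E3} (hv : ContDiff ℝ ∞ v)
    (hdiv : VectorCalculus.IsDivFree v) (hper : IsPer L v) :
    ∫ x, ‖Torus.laplacian (fun z => (L • v (L • Torus.repr z) : E3)) x‖ ^ 2 = L ^ 3 * Pal L v := by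
  obtain ⟨hw, hdivw, hperw⟩ := dilate_props hv hdiv hper
  set w : E3 → E3 := fun y => L • v (L • y) with hwdef
  set U : UnitAddTorus (Fin 3) → E3 := fun x => w (Torus.repr x) with hUdef
  have hlift : Torus.lift U = w := Torus.lift_descend_holds w hperw
  have hw2 : ContDiff ℝ 2 w := hw.of_le (by norm_cast)
  have hcw : ContDiff ℝ ∞ (curl w) := contDiff_curl_top hw
  have hpercw : IsLatticePeriodic (curl w) := isLatticePeriodic_curl hperw
  have hdivcw : VectorCalculus.IsDivFree (curl w) := fun y => divergence_curl_eq_zero_holds w hw2 y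
  set Ω : UnitAddTorus (Fin 3) → E3 := fun x => curl w (Torus.repr x) with hΩdef
  have hΩlift : Torus.lift Ω = curl w := Torus.lift_descend_holds (curl w) hpercw
  have hΩ : Torus.IsSmooth Ω := by
    show ContDiff ℝ ∞ (Torus.lift Ω); rw [hΩlift]; exact hcw
  have hΩ1 : Torus.IsContDiff 1 Ω := hΩ.isContDiff (by exact_mod_cast le_top)
  have hdivΩ : Torus.IsDivFree Ω := by
    refine (Torus.isDivFree_iff_trace_fderiv_lift hΩ1).2 fun y => ?_
    rw [hΩlift]
    exact hdivcw y
  -- pointwise `‖ΔU‖² = |curl curl w|² ∘ repr = torusVorticitySqAt Ω`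
  have hpt : ∀ x, ‖Torus.laplacian U x‖ ^ 2 = torusVorticitySqAt Ω x := by
    intro x
    rw [torusVorticitySqAt_descend hcw hpercw x, curl_curl_eq_neg_laplacian hw2 hdivw, norm_neg,
      ← hlift, Torus.laplacian_lift, Torus.proj_repr]
  rw [integral_congr_ae (ae_of_all _ hpt), integral_torusVorticitySqAt_eq_two_mul_torusEnstrophy hΩ hdivΩ,
    ← gradNormSq_eq_two_mul_torusEnstrophy]
  unfold Torus.gradNormSq
  have hD : ∀ (y : E3) (i : Fin 3),
      Torus.partialDeriv i Ω (Torus.proj y) = fderiv ℝ (curl w) y (EuclideanSpace.single i 1) := by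
    intro y i
    rw [Torus.partialDeriv_eq_fderiv_apply hΩ1, ← Torus.fderiv_lift, hΩlift]
  have h3 : ∀ x, (∑ i, ‖Torus.partialDeriv i Ω x‖ ^ 2) =
      (fun y => frobeniusNormSq (fderiv ℝ (curl w) y)) (Torus.repr x) := by
    intro x
    have hx : Torus.proj (Torus.repr x) = x := Torus.proj_repr x
    conv_lhs => rw [← hx]
    simp only [hD, frobeniusNormSq_eq_sum_single]
  have hperg : IsLatticePeriodic (fun y => frobeniusNormSq (fderiv ℝ (curl w) y)) := by
    intro j y
    show frobeniusNormSq (fderiv ℝ (curl w) (y + EuclideanSpace.single j 1)) =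
      frobeniusNormSq (fderiv ℝ (curl w) y)
    rw [isLatticePeriodic_fderiv hpercw j y]
  rw [integral_congr_ae (ae_of_all _ h3), integral_descend_eq_setIntegral_cell hperg]
  have h4 : (fun y => frobeniusNormSq (fderiv ℝ (curl w) y)) =
      fun y => L ^ 6 * frobeniusNormSq (fderiv ℝ (curl v) (L • y)) := by
    funext y
    rw [hwdef, fderiv_curl_dilate hv, frobeniusNormSq_smul]
    ring
  have h5 := setIntegral_cell_one_comp_smul hL (fun x => frobeniusNormSq (fderiv ℝ (curl v) x))
  beta_reduce at h5
  rw [h4, integral_const_mul, h5]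
  unfold Pal
  field_simp

/-- **`∫_{𝕋³}⟪(U·∇)U, ΔU⟫ = L³·∫_{T³_L} ω·(∇v)ω`** for the descended dilate: the torus identity
`∫⟪(U·∇)U, ΔU⟫ = ∫σ` (`σ = ωᵀ𝒟ω` on `T³`, Majda–Bertozzi (1.32)), read through the lift, then Leray
scaling. [cite: MajdaBertozziCUP2002, §1.4 eq. (1.32)] -/
theorem integral_convect_laplacian_descend_dilate {L : ℝ} (hL : 0 < L) {v : E3 → E3}
    (hv : ContDiff ℝ ∞ v) (hdiv : VectorCalculus.IsDivFree v) (hper : IsPer L v) :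
    ∫ x, ⟪Torus.convect (fun z => (L • v (L • Torus.repr z) : E3)) (fun z => (L • v (L • Torus.repr z) : E3)) x,
        Torus.laplacian (fun z => (L • v (L • Torus.repr z) : E3)) x⟫ = L ^ 3 * stretch L v := by
  obtain ⟨hw, hdivw, hperw⟩ := dilate_props hv hdiv hper
  set w : E3 → E3 := fun y => L • v (L • y) with hwdef
  set U : UnitAddTorus (Fin 3) → E3 := fun x => w (Torus.repr x) with hUdef
  have hlift : Torus.lift U = w := Torus.lift_descend_holds w hperw
  have hU : Torus.IsSmooth U := by
    show ContDiff ℝ ∞ (Torus.lift U); rw [hlift]; exact hw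
  have hU1 : Torus.IsContDiff 1 U := hU.isContDiff (by exact_mod_cast le_top)
  have hdivU : Torus.IsDivFree U := by
    refine (Torus.isDivFree_iff_trace_fderiv_lift hU1).2 fun y => ?_
    rw [hlift]
    exact hdivw y
  rw [StrainVorticityOrthogonality.integral_inner_convect_laplacian_eq_integral_torusStretchingDensity hU hdivU]
  have hD : ∀ (y : E3) (i j : Fin 3),
      Torus.partialDeriv j U (Torus.proj y) i = ent (fderiv ℝ w y) i j := by
    intro y i j
    rw [Torus.partialDeriv_eq_fderiv_apply hU1, ← Torus.fderiv_lift, hlift, ent]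
  have hpt : ∀ x, torusStretchingDensity U x =
      (fun y => ⟪curl w y, fderiv ℝ w y (curl w y)⟫) (Torus.repr x) := by
    intro x
    have hx : Torus.proj (Torus.repr x) = x := Torus.proj_repr x
    conv_lhs => rw [← hx]
    rw [torusStretchingDensity_fin_three_of_isDivFree hU1 hdivU]
    simp only [torusVorticityTensor, hD, inner_apply_eq_sum_ent, Fin.sum_univ_three]
    simp only [curl, ent]
    simp
    ring
  have hperg : IsLatticePeriodic (fun y => ⟪curl w y, fderiv ℝ w y (curl w y)⟫) := by
    intro j y
    show ⟪curl w (y + EuclideanSpace.single j 1),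
        fderiv ℝ w (y + EuclideanSpace.single j 1) (curl w (y + EuclideanSpace.single j 1))⟫ =
      ⟪curl w y, fderiv ℝ w y (curl w y)⟫
    rw [isLatticePeriodic_curl hperw j y, isLatticePeriodic_fderiv hperw j y]
  rw [integral_congr_ae (ae_of_all _ hpt), integral_descend_eq_setIntegral_cell hperg]
  have h4 : (fun y => ⟪curl w y, fderiv ℝ w y (curl w y)⟫) =
      fun y => L ^ 6 * ⟪curl v (L • y), fderiv ℝ v (L • y) (curl v (L • y))⟫ := by
    funext y
    rw [hwdef, curl_dilate hv, fderiv_dilate hv]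
    simp only [FunLike.coe_smul, Pi.smul_apply, map_smul, real_inner_smul_left,
      real_inner_smul_right]
    ring
  have h5 := setIntegral_cell_one_comp_smul hL (fun x => ⟪curl v x, fderiv ℝ v x (curl v x)⟫)
  beta_reduce at h5
  rw [h4, integral_const_mul, h5]
  unfold stretch
  field_simp

/-! #### §H3 Prop 4 (26): the enstrophy identity — kernel discharge of `Step_P4`, hence Thm 7 (`Step_T7`) -/

/-- **Prop 4 (Enstrophy equation) (26) p.8 l.62–67 holds — kernel discharge of `Step_P4`**: along every
`per`-periodic classical solution on `[0,T)`, at every interior time,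
`dΩ/dt = −2νP + 2∫_{T³} ω·(∇u)ω`. Proof: Leray-rescale to period `1`
(`IsClassicalNSSolutionOn.nsRescale_holds`), descend to `𝕋³` (`ClayVariants.torus_descend_of_periodic`),
restrict to a compact time interval around the rescaled time (`Torus.IsClassicalNSSolutionOn.mono`), apply
the torus `H¹` balance `d/ds ½‖∇U‖² = −ν∫|ΔU|² + ∫⟪(U·∇)U, ΔU⟫`
(`Torus.IsClassicalNSSolutionOn.hasDerivWithinAt_half_gradNormSq`, Foias–Manley–Rosa–Temam (A.55)), and
transport the three torus integrals back to the period cell (`gradNormSq_descend_dilate`,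
`integral_laplacian_sq_descend_dilate`, `integral_convect_laplacian_descend_dilate`) with the chain rule
in time. [cite: Wayman2026, Prop 4 (26) p.8 l.62–67] [cite: FoiasManleyRosaTemam2001, App. II.A (A.55)] -/
theorem step_P4_holds : Step_P4 := by
  intro ν T u₀ u p hν hS t ht
  have hc : 0 < per := per_pos'
  set c : ℝ := per with hcdef
  have hc2 : 0 < c ^ 2 := by positivity
  -- Leray rescaling to period 1 and descent to the torus
  have hresc := IsClassicalNSSolutionOn.nsRescale_holds hS.classical hc
  rw [nsRescaleForce_zero] at hresc
  have hset : (fun s : ℝ => c ^ 2 * s) ⁻¹' Ico 0 T = Ico 0 (T / c ^ 2) := by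
    ext s
    simp only [mem_preimage, mem_Ico]
    rw [lt_div_iff₀ hc2, mul_comm s]
    constructor
    · rintro ⟨h1, h2⟩
      exact ⟨by nlinarith [h1, hc2], h2⟩
    · rintro ⟨h1, h2⟩; exact ⟨by positivity, h2⟩
  rw [hset] at hresc
  have hmem : ∀ s ∈ Ico 0 (T / c ^ 2), c ^ 2 * s ∈ Ico 0 T := by
    intro s hs
    have : s ∈ (fun s : ℝ => c ^ 2 * s) ⁻¹' Ico 0 T := by rw [hset]; exact hs
    exact this
  have hperU : ∀ s ∈ Ico 0 (T / c ^ 2),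
      IsLatticePeriodic (nsRescale c u s) ∧ IsLatticePeriodic (nsRescalePressure c p s) := by
    intro s hs
    refine ⟨?_, ?_⟩
    · exact ClayVariants.isLatticePeriodic_smul_comp_smul (F := E3) (hS.perU _ (hmem s hs)) c
    · have h := ClayVariants.isLatticePeriodic_smul_comp_smul (F := ℝ) (hS.perP _ (hmem s hs)) (c ^ 2)
      simp only [smul_eq_mul] at h
      exact h
  obtain ⟨hTor, -⟩ := ClayVariants.torus_descend_of_periodic hresc hperU
  -- the rescaled time `s₀ = t/c²` is interior; restrict to `[0, b]` with `s₀ < b < T/c²`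
  set s₀ : ℝ := t / c ^ 2 with hs₀
  have hs₀pos : 0 < s₀ := div_pos ht.1 hc2
  have hs₀lt : s₀ < T / c ^ 2 := div_lt_div_of_pos_right ht.2 hc2
  set b : ℝ := (s₀ + T / c ^ 2) / 2 with hb
  have hs₀b : s₀ < b := by rw [hb]; linarith
  have hbT : b < T / c ^ 2 := by rw [hb]; linarith
  have hb0 : 0 < b := hs₀pos.trans hs₀b
  have hsub : Icc 0 b ⊆ Ico 0 (T / c ^ 2) := fun s hs => ⟨hs.1, hs.2.trans_lt hbT⟩
  have hTor' := hTor.mono hsub (uniqueDiffOn_Icc hb0)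
  have hder := (hTor'.hasDerivWithinAt_half_gradNormSq hb0 ⟨hs₀pos.le, hs₀b.le⟩).hasDerivAt
    (Icc_mem_nhds hs₀pos hs₀b)
  simp only [Pi.zero_apply, sub_zero] at hder
  -- the slice at `s₀` is the Leray dilate of `u t`
  have htmem : t ∈ Ico 0 T := ⟨ht.1.le, ht.2⟩
  have hut : ContDiff ℝ ∞ (u t) := hS.classical.contDiff_velocity htmem
  have hdivt : VectorCalculus.IsDivFree (u t) := hS.classical.divFree t htmem
  have hpert : IsPer per (u t) := hS.perU t htmem
  have hct : c ^ 2 * s₀ = t := by rw [hs₀]; field_simp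
  have hslice : nsRescale c u s₀ = fun y => c • u t (c • y) := by
    funext y; rw [nsRescale_apply, hct]
  have hB : ∫ x, ‖Torus.laplacian (fun x => nsRescale c u s₀ (Torus.repr x)) x‖ ^ 2 =
      c ^ 3 * Pal per (u t) := by
    rw [hslice]; exact integral_laplacian_sq_descend_dilate hc hut hdivt hpert
  have hC : ∫ x, ⟪Torus.convect (fun x => nsRescale c u s₀ (Torus.repr x))
        (fun x => nsRescale c u s₀ (Torus.repr x)) x,
        Torus.laplacian (fun x => nsRescale c u s₀ (Torus.repr x)) x⟫ = c ^ 3 * stretch per (u t) := by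
    rw [hslice]; exact integral_convect_laplacian_descend_dilate hc hut hdivt hpert
  rw [hB, hC] at hder
  -- `G(s) = ‖∇U(s)‖²` has derivative `2·(−νc³P + c³·stretch)` at `s₀`
  set G : ℝ → ℝ := fun s => Torus.gradNormSq (fun x => nsRescale c u s (Torus.repr x)) with hGdef
  have hG : HasDerivAt G (2 * (-ν * (c ^ 3 * Pal per (u t)) + c ^ 3 * stretch per (u t))) s₀ := by
    have h := hder.const_mul 2
    refine h.congr_of_eventuallyEq (Filter.Eventually.of_forall fun s => ?_)
    show G s = 2 * (2⁻¹ * G s)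
    ring
  -- `Ens per (u τ) = c⁻¹ · G(τ/c²)` near `t`
  have hA : ∀ τ ∈ Ioo 0 T, Ens per (u τ) = c⁻¹ * G (τ / c ^ 2) := by
    intro τ hτ
    have hτm : τ ∈ Ico 0 T := ⟨hτ.1.le, hτ.2⟩
    have hcτ : c ^ 2 * (τ / c ^ 2) = τ := by field_simp
    have hsl : nsRescale c u (τ / c ^ 2) = fun y => c • u τ (c • y) := by
      funext y; rw [nsRescale_apply, hcτ]
    have h := gradNormSq_descend_dilate hc (hS.classical.contDiff_velocity hτm)
      (hS.classical.divFree τ hτm) (hS.perU τ hτm)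
    rw [hGdef]
    show Ens c (u τ) = c⁻¹ * Torus.gradNormSq (fun x => nsRescale c u (τ / c ^ 2) (Torus.repr x))
    rw [hsl, h]
    field_simp
  -- chain rule in time and assembly
  have hinner : HasDerivAt (fun τ : ℝ => τ / c ^ 2) (1 / c ^ 2) t := by
    have := (hasDerivAt_id t).div_const (c ^ 2)
    simpa using this
  have hG' : HasDerivAt G (2 * (-ν * (c ^ 3 * Pal per (u t)) + c ^ 3 * stretch per (u t)))
      ((fun τ : ℝ => τ / c ^ 2) t) := by
    simpa only [hs₀] using hG
  have hcomp := hG'.comp t hinner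
  have hE := hcomp.const_mul c⁻¹
  have heq : (fun τ => Ens per (u τ)) =ᶠ[nhds t] fun τ => c⁻¹ * (G ∘ fun τ : ℝ => τ / c ^ 2) τ := by
    filter_upwards [Ioo_mem_nhds ht.1 ht.2] with τ hτ
    exact hA τ hτ
  refine (hE.congr_of_eventuallyEq heq).congr_deriv ?_
  field_simp
  ring

/-- **Thm 7 (Enstrophy estimate) (48) p.17 holds — kernel discharge of `Step_T7`** (with the sharp
classical constant inside `Kc`): `thm7_of_steps step_P4_holds step_P9_holds`.
[cite: Wayman2026, Thm 7 (48) p.17 l.47–55; proof p.18 l.2–7] -/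
theorem step_T7_holds : Step_T7 := stepT7_of_stepP4 step_P4_holds

/-! ### §I Thm 11 Step 3 «BKM closure» — kernel discharge of `Step11_3` (rev 6, ns-claims-lit-3 g8): the
inference `Step11_2 → Step11_3_interval → VortBound` holds as typed (`γ < 1`, `gam_lt_one`); with §F–§H this
discharges every TRUE binder of `claim_of_steps`, leaving the refuted head `Step_T9` and the interval
display `Step11_3_interval` (`claim_of_T9_interval`). -/

/-- `τ > 0`. [folklore] -/
private theorem tau_pos : 0 < tau := by unfold tau; positivity

/-- `λ₁ > 0`. [folklore] -/
private theorem lam1_pos : 0 < lam1 := by unfold lam1; positivity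

/-- `γ ≥ 0`. [folklore] -/
private theorem gam_nonneg : 0 ≤ gam := by
  unfold gam
  have h : 0 < Real.pi ^ 2 - 3 := by nlinarith [Real.pi_gt_three]
  positivity

/-- **Thm 8 (50) p.18: the loop gain is `< 1`** — `γ = (π²−3)/(2√3π) < 1` (numerically `≈ 0.631`; here from
`π < 3.15` and `√3 > 1.7`). [cite: Wayman2026, Thm 8 (50) p.18 l.69–83] -/
theorem gam_lt_one : gam < 1 := by
  unfold gam
  have hπ : Real.pi < 3.15 := Real.pi_lt_d2
  have hπ0 : 0 < Real.pi := Real.pi_pos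
  have hs : (1.7 : ℝ) < Real.sqrt 3 := by
    rw [Real.lt_sqrt (by norm_num)]; norm_num
  have hden : 0 < 2 * Real.sqrt 3 * Real.pi := by positivity
  rw [div_lt_one hden]
  have h1 : Real.pi ^ 2 < 3.15 * Real.pi := by nlinarith
  have h2 : 2 * 1.7 * Real.pi < 2 * Real.sqrt 3 * Real.pi := by nlinarith
  nlinarith

/-- `‖w‖_{L∞} ≥ 0` (a real supremum of norms). [folklore] -/
private theorem supN_nonneg (w : E3 → E3) : 0 ≤ supN w := Real.iSup_nonneg fun _ => norm_nonneg _

/-- **Thm 11 Step 3 «BKM closure» (73)–(74) p.27 l.33–75 holds as typed — kernel discharge of `Step11_3`**: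
the stroboscopic decay (72) and the interval display p.27 l.43–49 give an a priori sup-vorticity bound on
every slab. On `[kτ, t] ⊆ [kτ,(k+1)τ]` the display reads `S(t') ≤ S(kτ) + γ·sup_{[kτ,t']} S`; if
`sup_{[kτ,t]} S = M < ∞` this absorbs to `M ≤ S(kτ)/(1−γ) ≤ max C 0/(1−γ)` (`γ < 1`, `gam_lt_one`), and if
the sup is infinite the real supremum is `0` by convention and the display bounds `S(t)` by `S(kτ)` outright.
[cite: Wayman2026, Thm 11 Step 3 (73)–(74) p.27 l.33–75] -/
theorem step11_3_holds : Step11_3 := by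
  intro h2 hI ν hν u₀ hu₀ T u p hS
  obtain ⟨C, hC⟩ := h2 ν hν u₀ hu₀
  have hγ0 : 0 ≤ gam := gam_nonneg
  have hγ1 : gam < 1 := gam_lt_one
  have h1g : 0 < 1 - gam := by linarith
  have hτ : 0 < tau := tau_pos
  have hC' : 0 ≤ max C 0 := le_max_right _ _
  refine ⟨max C 0 / (1 - gam), fun t ht => ?_⟩
  set S : ℝ → ℝ := fun s => supN (curl (u s)) with hSdef
  have hS0 : ∀ s, 0 ≤ S s := fun s => supN_nonneg _
  obtain ⟨ht0, htT⟩ := ht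
  -- the stroboscopic interval containing `t`
  set k : ℕ := ⌊t / tau⌋₊ with hk
  have hkt : (k : ℝ) * tau ≤ t := by
    have h : (k : ℝ) ≤ t / tau := Nat.floor_le (div_nonneg ht0 hτ.le)
    exact (le_div_iff₀ hτ).1 h
  have htk1 : t ≤ ((k : ℝ) + 1) * tau := by
    have h : t / tau < (k : ℝ) + 1 := Nat.lt_floor_add_one (t / tau)
    exact ((div_lt_iff₀ hτ).1 h).le
  have hkT : (k : ℝ) * tau < T := hkt.trans_lt htT
  have hk0 : (0 : ℝ) ≤ (k : ℝ) * tau := by positivity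
  have hSk : S ((k : ℝ) * tau) ≤ max C 0 := by
    have h : S ((k : ℝ) * tau) ≤ C * gam ^ k := hC T u p hS k hkT
    have hg : gam ^ k ≤ 1 := pow_le_one₀ hγ0 hγ1.le
    have hgk : 0 ≤ gam ^ k := pow_nonneg hγ0 _
    nlinarith [le_max_left C 0, mul_le_mul_of_nonneg_left hg hC']
  -- the interval display on `[kτ, t]`, exponential factor dropped
  have hdisp : ∀ t' ∈ Icc ((k : ℝ) * tau) t,
      S t' ≤ max C 0 + gam * ⨆ s : Icc ((k : ℝ) * tau) t', S (s : ℝ) := by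
    intro t' ht'
    have ht'T : t' ∈ Ico 0 T := ⟨hk0.trans ht'.1, ht'.2.trans_lt htT⟩
    have h := hI ν T u₀ u p hν hS k t' ht'T ht'.1 (ht'.2.trans htk1)
    have hexp : Real.exp (-(ν * lam1 * (t' - (k : ℝ) * tau))) ≤ 1 := by
      rw [Real.exp_le_one_iff]
      have : 0 ≤ ν * lam1 * (t' - (k : ℝ) * tau) :=
        mul_nonneg (mul_nonneg hν.le lam1_pos.le) (by linarith [ht'.1])
      linarith
    have hprod : Real.exp (-(ν * lam1 * (t' - (k : ℝ) * tau))) * S ((k : ℝ) * tau) ≤ max C 0 := by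
      calc Real.exp (-(ν * lam1 * (t' - (k : ℝ) * tau))) * S ((k : ℝ) * tau)
          ≤ 1 * S ((k : ℝ) * tau) := mul_le_mul_of_nonneg_right hexp (hS0 _)
        _ ≤ max C 0 := by rw [one_mul]; exact hSk
    have h' : S t' ≤ Real.exp (-(ν * lam1 * (t' - (k : ℝ) * tau))) * S ((k : ℝ) * tau) +
        gam * ⨆ s : Icc ((k : ℝ) * tau) t', S (s : ℝ) := h
    linarith
  by_cases hbdd : BddAbove (Set.range fun s : Icc ((k : ℝ) * tau) t => S (s : ℝ))
  · set M : ℝ := ⨆ s : Icc ((k : ℝ) * tau) t, S (s : ℝ) with hM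
    have hne : Nonempty (Icc ((k : ℝ) * tau) t) := ⟨⟨t, hkt, le_rfl⟩⟩
    have hle : ∀ t' ∈ Icc ((k : ℝ) * tau) t, (⨆ s : Icc ((k : ℝ) * tau) t', S (s : ℝ)) ≤ M := by
      intro t' ht'
      have hne' : Nonempty (Icc ((k : ℝ) * tau) t') := ⟨⟨(k : ℝ) * tau, le_rfl, ht'.1⟩⟩
      refine ciSup_le fun s => ?_
      exact le_ciSup hbdd ⟨(s : ℝ), s.2.1, s.2.2.trans ht'.2⟩
    have hMle : M ≤ max C 0 + gam * M := by
      refine ciSup_le fun s => ?_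
      calc S (s : ℝ) ≤ max C 0 + gam * ⨆ r : Icc ((k : ℝ) * tau) (s : ℝ), S (r : ℝ) := hdisp s s.2
        _ ≤ max C 0 + gam * M := by
          have := hle s s.2
          nlinarith
    have hSt : S t ≤ M := le_ciSup hbdd ⟨t, hkt, le_rfl⟩
    have hMb : M ≤ max C 0 / (1 - gam) := by
      rw [le_div_iff₀ h1g]; nlinarith
    exact hSt.trans hMb
  · have h0 : (⨆ s : Icc ((k : ℝ) * tau) t, S (s : ℝ)) = 0 := Real.iSup_of_not_bddAbove hbdd
    have h := hdisp t ⟨hkt, le_rfl⟩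
    rw [h0, mul_zero, add_zero] at h
    have hle : max C 0 ≤ max C 0 / (1 - gam) := by
      rw [le_div_iff₀ h1g]; nlinarith
    exact h.trans hle

/-- `Step11_3` — `_holds` alias of `step11_3_holds` above under the fact's exact name (appended
2026-08-28, D-0026 bookkeeping: the proof term is the existing theorem of this file; no statement,
definition or attribute is edited; no new named fact; the ledger's debt table listed the fact
unproved). [cite: Wayman2026, Thm 11 Step 3 (73)–(74) p.27 l.33–75] -/
theorem _root_.Literature.Claims.NS.Wayman2026.Step11_3_holds : Step11_3 :=
  _root_.Literature.Claims.NS.Wayman2026.step11_3_holds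

/-- **Corollary.** With `Step11_3` discharged, (72) and the interval display already give the a priori
sup-vorticity bound, hence Thm 13 (1) (`thm13_1_of_vortBound`). [cite: Wayman2026, Thm 11 Steps 2–3 p.27] -/
theorem thm13_1_of_step11_2_interval (h2 : Step11_2) (hI : Step11_3_interval) : Thm13_1 per :=
  thm13_1_of_vortBound (step11_3_holds h2 hI)

/-- **Corollary — the printed chain modulo its two flagged displays.** The full composition
`claim_of_steps` with every TRUE binder discharged in-kernel: the headline follows from the refuted head
`Step_T9` (Thm 9 (53)) and the interval display `Step11_3_interval` (p.27 l.43–49) alone.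
[cite: Wayman2026, Thm 11 p.26–27; Thm 13 p.30–31] -/
theorem claim_of_T9_interval (h9 : Step_T9) (hI : Step11_3_interval) : ClaimedTheorem :=
  claim_of_steps step11_1_holds h9 hI step11_3_holds step11_unique_holds step_L2_holds

end PropNine

end Literature.Claims.NS.Wayman2026

end

-- WHAT THIS IS NOT: not a claim about NS regularity or blow-up; not a claim about any author beyond the typed locator.
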